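import Mathlib
import Literature.MathematicalPhysics.QuantumFieldTheory.Balaban1983to89.T4DefectFluxForm

/-!
# T⁴ programme, node NE3 (η-rate of the minimisers) — COVARIANT DEFECT ALGEBRA:
# the readings (α)(β)(γ) of the flux form as exact kernel algebra, and the weight budget of clause (F4)

Eighth-generation leaf of the NE3 prover lineage P1 (technique: implicit-function / fixed-point structure of the
one-step constrained variational problem, Bałaban CMP 102 (1985) 277–309 = "B11", Sect. E, read as the DISCRETE
implicit-function theorem = STABILITY × CONSISTENCY).  A NEW LEAF: it imports `T4DefectFluxForm` (v1.2: the flux form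
`K = Σ_μ ∂⁺_{c,μ}∘(q_⊥μ ⊗ Ψ_μ)∘∂³_{f,μ}` of the two-grid defect of COMMUTING block means, the re-cut wall `FluxSized`
(F1)–(F5), `ne3Shape_of_fluxSized_rpow`) and touches nothing in it.  v1.1 (additive): §6 the HÖLDER BUDGET — the
wall with a `β`-deficient remainder clause still reaches `NE3Shape` BY NAME at every rate `a < β`
(`ne3Shape_of_fluxSizedHolder_rpow`) — and the first-order content of the compensation (α′) in the abelian scalar
model for `d = 2, 3, 4`, recorded as dictionary + toy below (item (4′)).  v1.2 (DOCFIX, docstring only): the B9 (3.35)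
span restored byte-identical to the certified one (XREAD C-ref5-178 item L1); every declaration unchanged.  v1.3
(additive): §7 the GAUGE-MODE IDENTITY of the vector averaging shape (B7 (14) / (124) main term) as exact telescoping
algebra, and item (4″) — the d = 2 VECTOR model of (α′): the comb LEGS compensate the line-sum first moment, the
residue lives in the gauge channel and the `ad F` coupling of the RG-defined forms (dictionary + toy).  v1.4
(docstring only; §1–§7 byte-identical to v1.3): item (4‴) — with the EXACT charged Wilson Hessian at both scales, `Ū`
(15) and B7's axial-gauge LINE-SUM averaging `Q₀` (p. 28) the d = 2 vector model has NO first-order words of weight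
≤ 3 (L = 2, 3, 4); the full-contour form differs from it exactly by a coarse gauge mode and an off-shell current
word — the linearised B7 (59)–(62); item (4″)'s residue is thereby relocated to the operator/averaging PAIRING.
v1.5 (docstring only; §1–§7 byte-identical to v1.3/v1.4): item (4⁗) — the same tables in d = 3 (L = 2, 3, 4) and
d = 4 (L = 2) over every single-carrier abelian background (in-plane and Bianchi-paired out-of-plane curvature
gradients): the line sum `Q₀` with the exact Wilson Hessians and `Ū` (15) has NO first-order words of weight ≤ 3;
contour − line = exact coarse gauge mode + coarse current word, the latter vanishing identically on the ON-SHELL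
gradient backgrounds; and B9 (3.15) [R] composes the contour forms (124), which fixes the chain's averaging.
v1.6 (docstring only; §1–§7 byte-identical to v1.3–v1.5): item (4⁗′) — LOCATED PRINT for the two residual words,
read on the page images: B7 (64), (67), (70); B9 (3.20)–(3.25); B11 (170)–(171), (181); and the reading they force
[model]: the coarse gauge mode is the linearisation of B7 (70) (averages transform by RESTRICTION; §7 is its linear
form) and is absent in the block axial gauge, minimisers being gauge-covariant by B11 (181); the current word is
the off-shell gauge-variance of the bare Wilson Hessian, `H_U D_Uλ = [J(U), λ]`, with `J` a constraint force by
B11 (170)–(171) and of printed sup size (10) (weight 3, insufficient alone); next test = the Lagrangian Hessian.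
v1.7 (docstring only; §1–§7 byte-identical to v1.3–v1.6): item (4⁗″) — that test RUN (toy `toy_lagr.py`): the
Lagrangian Hessian annihilates `D_Uλ` EXACTLY iff `λ` vanishes at the coarse lattice SITES (checked to 8e−8 /
8e−11 against a bare word 8e−3 / 8e−4, d = 2, 3), but Bałaban's residual gauge B7 (81) [R] pins block MEANS
(`Q′λ = 0`, B9 (3.21)), on which the residual keeps the bare size (ratio 0.74–1.46), and the operator swap
`H → H − μ·d²Ū` is two-grid INCONSISTENT (ψ-words ∝ L^{d+2}); the Lagrangian route is closed — the current
word is governed by the test space, B11 (170)–(171), i.e. by the typing of the fluctuation space.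
v1.8 (docstring only; §1–§7 byte-identical to v1.3–v1.7): item (4⁗‴) — CORRECTION of the (b′) wording of items
(4⁗′)/(4⁗″) by the toy ON GAUGE MODES (`toy_gm2.py`, `toy_bc.py`): in the LINE-SUM form every word through weight 4
vanishes on smooth gauge modes and the first-order words vanish on the blockwise covariantly-constant modes of B11
(181) — the fine and coarse current words CANCEL (two-grid current consistency) — so NO first-order word remains in
the line-sum form on any input; every first-order word of the covariant defect is in the legs of (124) outside the
block axial gauge, structural by B7 (64)/(67)/(70), B11 (181); the residual is TYPING only.

## The point (MODEL mathematics: exact ring algebra, one normed telescoping, real arithmetic; the dictionary is stated,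
## never asserted)

Generation 7 typed the consistency remainder of Bałaban's covariant objects as clause (F4) of `FluxSized`
(`blk ≤ C_B(1 + k log L)²·λ̂`, λ̂ = sup of the one-step multiplier) and left three READINGS, (α) the covariant block
means of B7/B9 are products of one-dimensional comb means and the covariant Laplacian a sum of one-dimensional ones UP
TO curvature commutators, (β) the one-dimensional flux identity survives covariantly, (γ) the two-path transports of
the comb telescope.  This leaf makes the algebra behind (α)(β)(γ) EXACT and draws the one consequence that matters for
the wall: a WEIGHT BUDGET.

 (1) NON-COMMUTATIVE FLUX EXPANSION (§1, any ring, no hypothesis).  For an ordered product of means `P = ∏_l q` the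
     defect `P·(Σ_l a) − (Σ_l b)·P` splits EXACTLY into (main) `Σ_i T_{<i}(q_ia_i − b_iq_i)D_{>i}` — transverse means
     around the one-dimensional defects, the commuting flux form of `T4DefectFluxForm.defect_product_list` — plus
     (fine crossings) `Σ_i T_{≤i}[D_{>i}, a_i]` plus (coarse crossings) `Σ_i [T_{<i}, b_i]D_{≥i}`
     (`defect_split`, `defect_split_sum`, `defect_split_list`; `splitFine = splitCoarse = 0` under commutation,
     `defect_split_list_of_comm`).  Which Laplacian crosses which mean is forced by typing: the fine one crosses the
     means applied BEFORE its own direction is averaged, the coarse one those applied AFTER.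
 (2) CROSSING CALCULUS (§2, any ring).  If `T·X − X·T = E·T` ("one commutator costs one curvature factor `E`") then for
     every power and every NON-NEGATIVE INTEGER STENCIL `q = Σ_t w_t T^t`:
        `q·X − X·q = m₁(q) • E + (T − 1)·A + B·(T − 1)`,   `m₁(q) = Σ_t t·w_t` the FIRST MOMENT of the stencil,
     with explicit remainders `A`, `B` (`crossing_moment`, `stencil_crossing`; corner block sums: `m₁ = L(L−1)/2`,
     `blockSum_crossing`; centred stencils: the ± halves pair into gradient words, `crossingDatum_inv`,
     `centred_moment_is_gradient`).  The datum `E` for Bałaban's lattice: covariant shifts with the plaquette relation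
     `T₁T₂ = H·T₂T₁` — a DEFINITION of the holonomy `H = T₁T₂T₁⁻¹T₂⁻¹`, not a constraint
     (`plaquette_relation_of_holonomy`) — give `E = (H − 1)T₂` for the forward and `E = S₂(H⁻¹ − 1)` for the backward
     transverse shift (`crossingDatum_fwd`, `crossingDatum_bwd`; full Laplacian `crossingDatum_lap`,
     `blockSum_crossing_lap`), and the PAIR sums to
        `(H − 1)T₂ + S₂(H⁻¹ − 1) = (H − 1)(T₂ − S₂) + [(H − 1) − S₂(H − 1)T₂]·S₂ + S₂H⁻¹(H − 1)²`      (`pair_leading`)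
     = curvature × centred difference + (covariant difference of the curvature) × shift + second order.
 (3) THE WEIGHT BUDGET (§5, real arithmetic; dictionary below).  Count `w` = 2 for each curvature factor `H − 1`
     (size `α₀η²`, η = L⁻ᵏ, B9 (3.35)) + 1 for each lattice difference falling on the curvature, on the propagated
     function, or standing leftmost as a coarse divergence.  In the (115) currency of this lineage a bulk remainder of
     weight `w` contributes `z ~ α₀·η^{w−4}·λ̂`; clause (F4) — indeed any rate at all — needs `w ≥ 4`
     (`not_fluxClause4_of_quadratic`: a remainder `≥ c·(L⁻ᵏ)²` at one datum contradicts (F4) ∧ (F5); conversely a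
     remainder `≤ C·(L⁻ᵏ)³` re-enters `FluxSized` with `λ̂` replaced by `max(λ̂, (L⁻ᵏ)³)`, `fluxSized_of_cubicBlk`).
     By (2) every crossing of a full Laplacian `X = L²(T₂ + S₂ − 2)` through a mean `q` has weight ≥ 4 EXCEPT the
     first-moment term `m₁(q)·L²·[(H − 1)T₂ + S₂(H⁻¹ − 1)]`, which has weight 3.  CORNER-ANCHORED comb means (B7 (2),
     CMP 95 (1.6): blocks `y_μ ≤ x_μ < y_μ + L`) have `m₁ = L(L − 1)/2 ≠ 0`; centred stencils have `m₁ = 0`.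
 (4) COMPENSATION (dictionary + located print + toy; NOT a kernel statement).  With STRAIGHT-PRODUCT coarse links the
     weight-3 term survives: in the flat-curvature abelian toy the covariant defect `K = Q(L²Δ_f ·) − Δ_c(Q ·)` has the
     exact mixed coefficient `∂²K/∂φ∂p₁ = +L²(L − 1) = 2m₁L²`, `∂²K/∂φ∂p₂ = −L²(L − 1)` (φ = curvature, p = momentum of
     the section; 4, 18, 48, 100 for L = 2, 3, 4, 5, both comb orders) — one step of it costs `osc = O(α₀L³B)`, no
     decay.  Bałaban's coarse background is NOT the straight product: B7 (15) averages `log U(Γ_{c,x})U(c)⁻¹` over the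
     block, and the contour `Γ_{c,x}` (CMP 95 (1.7)–(1.8), B7 p. 19) runs along the comb legs, so the excess factor
     `Θ_c := Ū_cU(c)⁻¹` carries exactly the transverse first moment of the comb holonomies.  Writing the compensated
     coarse Laplacian as `b = b_straight + (Θ − 1)T^L + S^L(Θ⁻¹ − 1)` (`coarseLap_compensated`; its pair again obeys
     `pair_leading`) the defect is the straight expansion MINUS `(Σ_μ θ_μ)·P` (`defect_split_sum_compensated`), and the
     weight-3 parts cancel iff `Θ_μ − 1 ≐ L·m₁·Σ_{ν≠μ}(H_{νμ} − 1)` at leading order — true for constant abelian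
     curvature [toy: residual ≤ 2·10⁻³ = O(h) of the finite differences, L = 2,…,5, both comb orders; centred blocks:
     0 in all modes; no weight-2 term in any mode], NOT PRINTED as a statement about Bałaban's `Ū` in general
     (B7 Prop. 1 bounds `Ū`, it does not expand it in the curvature).  So reading (α) splits into (α-main) = (1)+(5),
     exact, and (α′) = the compensation, which is WHERE clause (F4) now lives for the crossing remainders.
 (4′) (α′) AT FIRST ORDER, GENERAL `d` (v1.1; toys, abelian scalar MODEL, B7 (15) EXACTLY as the group-valued
     log-average, CMP 95 (1.7) comb order and its reverse, every plaquette orientation, backgrounds and sections built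
     from PRODUCTS OF LINKS; d = 2, 3, 4, L = 2, 3; d = 2 also L = 4, 5).  (i) The compensated defect has NO weight-2 and
     NO weight-3 content: for linear curvature profiles `F_{ab} = φ + ψx_g` all of `∂K/∂φ`, `∂K/∂ψ`, `∂²K/∂φ∂p_i`
     vanish (≤ 1.1·10⁻⁴ = finite-difference noise; straight links: `L²(L−1)`, `L²(L−1)/2`).  (ii) Its weight-4
     (curvature GRADIENT) × (momentum of the section) content responds to the MAXWELL combination only: the coefficient
     of `(∇_gF_{ab})·(∇_iu)` is `c(L)·[g = a ∧ i = b]` (`c(2) = 1`, `c(3) = 6`; every transverse gradient `g ∉ {a,b}`: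
     0; straight links: ±2, ±18 there) — i.e. `c(L)·Σ_b(d^*F)_b∇_bu`, and `d^*F = ∂^{η*}∂^ηA` IS printed at the
     Lipschitz scale (B11 (10)).  (iii) Its pure-curvature (`s = 0`) functional — `K` applied to the comb-transported
     constant section, a gauge-invariant scalar, probed by single-link responses `k(x, μ)` — has vanishing moments of
     order ≤ 2 (d = 4, L = 2: of order ≤ 3) AND a symbol vanishing at EVERY aliasing frequency `ξ ∈ (2π/L)ℤ^d ∖ 0`:
     it lies in the ideal (coarse differences)·(fine differences), so it is a sum of words `∂_{c,μ}[(b ⋆ ∇F)u]`, on the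
     printed budget with `sup|∇F|` (in d = 2 checked on the canonical plaquette functional as well).  Consequence in the
     model: every first-order word is sized by `sup|F|` (B9 (3.35)) and ONE curvature difference; second order in the
     curvature and commutator (non-abelian) corrections carry two curvature factors, weight ≥ 4 by counting.  NOT
     obtained: the same for Bałaban's VECTOR small-field operators (1-forms with the `ad F` coupling of the Yang–Mills
     Hessian, non-abelian transports) — the located remaining content of (α′).
 (4″) (α′) FOR 1-FORMS, d = 2 (v1.3; §7 + toy `…/g8/toy_vec2d.py`, charged component on an abelian background, MODEL).
     Bałaban's averaging of 1-forms (B7 (14); the main term of the linearisation (124) used by B9 (3.13)–(3.15)) sums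
     the TRANSPORTED bond variables over the whole contour `Γ_{c,x} = Γ_{y,x} ∪ [x, x + Lν] ∪ Γ_{x+Lν,y+Lν}⁻¹` — the
     straight LINE SUM plus the two comb LEGS — and means over `x ∈ B(y)`.  KERNEL (§7, any ring): along any contour
     the transported linearised gauge mode telescopes (`contour_telescope`, bond terms `contourTerm_fwd`/`_bwd`), so
     the averaging maps a gauge mode `D₀λ` to `L⁻¹[P̄·λ(y + Lν) − λ(y)]`, `P̄` = the block mean of the contour
     holonomies = the pre-projection average of B7 (15) (`contourSum_gauge`): gauge modes go to COARSE gauge modes with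
     the (15) transport — the linearisation of B7's covariance, and the reason legs and (15) belong together [toy
     control: 6.9·10⁻¹⁷].  TOY (two-grid defect `Qv(L²M_f·) − M_c(Qv·)` with RE-DISCRETISED coarse operators, L = 2,
     3, both comb orders, integers `c = L²(L−1)`, `c/2`): (i) the line sum ALONE leaves the diagonal weight-3 words
     `F_{νρ}·∇_ρW_ν` (±c) and `(∇_ρF_{νρ})·W_ν` (±c/2) even with (15); (ii) WITH THE LEGS and (15) the diagonal channel
     of the componentwise covariant Laplacian is CLEAN (0.000) — the legs cancel the line-sum first moment exactly —
     and the only residue is off-diagonal, `[M_c, d_c]` acting on the leg potential: curvature × a coarse pure-gauge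
     datum (channel (G)); (iii) the `ad F` coupling adds magnetic×legs words (±c/2) and, in the linearised-curl
     Weitzenböck form, re-discretisation words (±c), linearly in the magnetic moment — no moment clears weight 3 in the
     re-discretised class (channel (M)).  READING: «coarse operator = covariant Laplacian with `Ū` (15)» has NO
     faithful vector analogue; (α′) for 1-forms is a property of the RG-DEFINED, exactly coarse-gauge-invariant forms
     (B9 (3.12)–(3.16), B11 §E (115)–(121); gauge fixing (3.17)–(3.19)) in the channels (G)/(M) — typable only over
     typed averaging operators AND a typed `Δ_k(U)`; `not_fluxClause4_of_quadratic` says an uncompensated word is fatal.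
 (4‴) (α′) FOR 1-FORMS WITH THE EXACT WILSON HESSIAN, d = 2 (v1.4; toys `…/g8/toy_vec2d_w.py` (331fe12d9cb4cbd8),
     `toy_vec2d_x.py` (e136d6a8dbb177d0), `probe_legs2.py`; MODEL: charged component, abelian background `F = φ + ψ·x_g`).
     Operator at BOTH scales := the exact Hessian of `Σ_p [1 − ½ Re tr U(∂p)]` in the charged sector (SU(2) links
     `e^{iX}B`, `X = wσ₊ + w̄σ₋`, exact polarisation; coarse links `Ū` = B7 (15)); at `F = 0` it IS `D₁*D₁` (ratio
     1.000000) and it obeys the Ward identity `H·D₀λ = 0` on-shell to 8.7·10⁻¹⁶ (off-shell the defect is the current,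
     linear in `ψ`).  THREE linearised averagings of 1-forms: (L) the TRANSPORTED LINE SUM — B7's `Q₀` for
     configurations in the block axial gauge (58) [p. 28 [R]: «(Q₀A)(c) = Σ_{x∈B(c₋)} L^{-d}(R₀,c₋A)([x, x(c)])»; CMP 95
     (1.11), (1.18)]; (C) the full-contour main term of (124) = line + comb legs (item (4″)); (E) the EXACT
     linearisation of (14)–(15) by SU(2) matrix log/exp, i.e. every term of (124) [controls: `Ū_SU(2) = Ū_(15)` to
     2·10⁻¹⁶; exact covariance to 5·10⁻¹⁴; `Q_E − Q_C` is LINEAR in the curvature, 4.6·10⁻³·|Q| at `φL² = 0.3`].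
     TABLES (two-grid defect `K = Q(L²H_f·) − H_c(Q·)` on `W = e_ρu_p`; L = 2, 3 [4]; both comb orders; both `∇F`
     directions; on-shell `φ`- AND current `ψ`-columns; `c = L²(L−1)` = 4, 18, 48):
       (L) + `Ū`(15): EVERY weight-2 and weight-3 word VANISHES — maxima 0.0000 / 7·10⁻⁴ / 1.4·10⁻² at L = 2 / 3 / 4,
       residuals `O(h²)` (halving h divides them by 4–5); the same for the gauge-fixing form `D₀D₀*` and for
       `H + D₀D₀*`.  (L) + straight-product coarse links: words `c`.  (C) + `Ū`(15) and (E) + `Ū`(15): IDENTICAL tables,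
       words `c/2, c, 3c/2` (the remaining terms of (124) do not enter at weight ≤ 3).  The re-discretised `D₁*D₁`,
       componentwise Laplacian and Weitzenböck form keep words `c/2, c` even under (L): what the line sum intertwines
       is the exact Hessian of a gauge-INVARIANT plaquette action.
     STRUCTURE of (C) − (L) (exact linear algebra given §7, confirmed to table precision at L = 2, 3): with `Λ(V)(y)` :=
     the block mean of the transported comb-leg integrals of `V` (the linearisation of B7 (62): «v(y) = exp[−i Σ_{x∈B(y)}
     L^{-d} (1/i) log(R₀,yV₁)(Γ_{y,x})]»),  `K_C(A) = K_L(A) − d_c[Λ(L²H_f A)] − H_c(d_cΛ(A)) + (weight ≥ 4)`: the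
     second term is an EXACT COARSE GAUGE MODE (all `φ`/`φp`-words of (C) sit in it: `legs(V) + d_cΛ(V)` has empty
     tables), the third is the coarse Ward word `J_c ⋆ Λ(A)` — zero `φ`- and `φp`-columns, `ψ`-column `c/2` exactly, in
     the current's direction only — i.e. it vanishes for ON-SHELL coarse backgrounds and is linear in `d*F` otherwise.
     This is the linearised form of B7 (59) [p. 27 [R]: «V̄_c(V̄₀)_c⁻¹ = v(c₋)(V₁V₀)‾_c(V̄₀)_c⁻¹ R̄₀,c v⁻¹(c₊)» — the
     average of the axial representative equals the full average of the re-gauged smooth one conjugated by the corner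
     gauge transformation `v` of (60)–(62)], and of the caveat printed for (L) on p. 28 [R]: «There are troubles with
     the second term because … this expression is only approximately equal to R(V₀(c))(Q′₀λ)(c₊), because
     V₀(Γ_{c,x}∪(−c)) are close to 1 for V₀ regular, but not necessarily equal to 1» — that covariance defect of `Q₀`
     on gauge modes is weight ≥ 4 inside `K` [tables].  READING (relocates (4″)): in the model, (α′) for 1-forms HOLDS
     at first order for the pairing ⟨exact Wilson Hessians, `Ū` (15), axial-gauge line sum `Q₀`⟩ that B7 pp. 27–28
     prints for the one-step transformation [«this is very important because the explicit representations of
     propagators, and other formulas, hold for this specific form of the averaging operation», p. 27 [R]]; applied to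
     smooth (Landau-type-gauge) sections, the full-contour form is consistent MODULO an exact coarse gauge mode and the
     off-shell current word.  Located remaining content of (α′-op) for vectors: (i) the gauge bookkeeping of the
     chain's `τ = K·U_{k+1}` / `X = U_k − Q₁U_{k+1}` (which representative, which averaging at each of the k steps of B9
     (3.15); the coarse gauge mode `−d_cΛ(L²H_fU_{k+1})` must be quotiented or tracked, B7 (59)–(63)); (ii) the
     current word `J_c ⋆ Λ` against the printed bound on the Maxwell combinations `d*F` of the constrained minimisers
     (B11 (10)) — as a bare weight-3 word with `r = 1` it is OFF the printed budget (`onPrintedBudget`: 0+1+0 < 2);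
     (iii) non-abelian `Ū`/commutator corrections (weight ≥ 4 by counting [model]); (iv) d = 3, 4 tables; (v) the
     typing (U1a: averaging operators + a typed `Δ_k(U)`).
 (4⁗) (α′) FOR 1-FORMS WITH THE EXACT WILSON HESSIAN, d = 3 AND d = 4 (v1.5; toys `…/g8/toy_vecd_w.py`
     (be6a55880600fe3b), `probe_legs_d.py` (5595d9f591304612): the d-dimensional rewrite of item (4‴)'s toy — d = 2
     with the profile `F₁₂ = φ + ψx₁` reproduces item (4‴)'s tables exactly; MODEL as there).  Backgrounds := every
     abelian lattice potential carried by ONE link direction `a` (Bianchi identity automatic): in-plane gradients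
     `F_{ba} = φ + ψx_b` (d(d−1) profiles; off-shell, `d*F = ψ ≠ 0`) and out-of-plane gradients with their Bianchi
     partner `F_{ba} = φ + ψx_c`, `F_{ca} = ψx_b` (d(d−1)(d−2) profiles; ON-SHELL: `d*F ≡ 0` although `∇F ≠ 0` — the
     Ward identity of the Wilson Hessian is exact to 10⁻¹⁵ there at ψ ≠ 0); test forms `W = e_ρu_p`, all d² pairs
     (ν, ρ), all d momentum directions.  TABLES (`c = L²(L−1)`):
       d = 3, (L) + `Ū`(15), all 12 profiles, both comb orders: NO weight-2/3 words — maxima 0.0000 (L = 2; 24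
       tables), ≤ 7·10⁻⁴ (L = 3; 24 tables), ≤ 1.4·10⁻² (L = 4; 4 profiles; 2.9·10⁻³ at h = 5·10⁻⁴) against c = 4,
       18, 48; the same for `D₀D₀*`; the re-discretised `D₁*D₁` keeps words c/2, c; straight-product coarse links:
       words c (L = 2, all profiles).
       d = 4, L = 2, (L) + `Ū`(15), all 36 profiles: NO weight-2/3 words (0.0000); `D₀D₀*` likewise; `D₁*D₁`: c/2, c.
       Contour form (C) + `Ū`(15): words c/2, c, 3c/2 in d = 3 (L = 2, 3; 12 profiles) and d = 4 (L = 2), decomposed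
       EXACTLY as in item (4‴): `legs(V) + d_cΛ(V)` has EMPTY tables for every profile (d = 3: L = 2, 3; d = 4:
       L = 2), and `H_c(legs W)` is the coarse current word — ψ-column c/2 on the OFF-SHELL in-plane profiles and
       IDENTICALLY ZERO (0.0000 / ≤ 4·10⁻⁴) on the ON-SHELL out-of-plane-gradient profiles: on an on-shell background
       with `∇F ≠ 0` the contour form differs from the line sum by an exact coarse gauge mode ONLY, at weight ≤ 3.
     LOCATED PRINT for the chain [R this generation]: B9 p. 393 (3.15) «Q_j(U) = Q(Ū^{j−1})·…·Q(Ū)Q(U), where Q(V)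
     is given by the explicit formula (124) in [5]» — the k-step averaging inside `Q*aQ` (3.16) COMPOSES THE CONTOUR
     FORMS (C); (3.17) the gauge-fixing density `exp(−‖D*A‖²/2α)(Z′⁻¹∫dλ δ(Q′λ) exp(−‖D*A^λ‖²/2α))⁻¹` with «A^λ =
     A − Dλ»; (3.19) «(Q′(V)λ)(y) = Σ_{x∈B(y)} L^{−d} R(V(Γ_{y,x}))λ(x)»; B7 p. 29 «The same reasoning can be applied
     to a higher order average Ū^k, where … U′ satisfies a sequence of axial gauge conditions in blocks», (64)–(69),
     and the change of gauge (70)–(76).  READING [model]: item (4‴)'s (iv) is discharged in the model (d = 3, 4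
     behave as d = 2); since the chain's averaging is the contour form (B9 (3.15)), the first-order residue of (α′)
     for the chain's `τ = K·U_{k+1}` IS the exact coarse gauge mode `−d_c[Λ(L²H_fU_{k+1})]` — its generator a block
     functional of the FINE FIELD-EQUATION RESIDUAL `H_fU_{k+1}` — plus the coarse current word `J_c ⋆ Λ(U_{k+1})`,
     zero when the coarse background is on-shell; what must be shown is that the consumer of `τ` (`(1 − Π)G_c` and
     the (115) currency, under B9's gauge fixing (3.17) `δ(Q′λ)`) quotients the former and that B11 (10) sizes the
     latter — items (i), (ii) of (4‴), now with their printed homes; (iii) non-abelian corrections and (v) the typing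
     are unchanged.
 (4⁗′) LOCATED PRINT FOR THE TWO RESIDUAL WORDS OF (4‴)/(4⁗), AND THE READING THEY FORCE (v1.6).  [R this
     generation, page images]: B7 p. 29 (64) «(R_{0,y}U′)(Γ_{y,x}) = 1, x ∈ B(y), x ≠ y, y ∈ Ω^{(1)}», (67) the same
     at level j, (70) «Ū^j_b = (\overline{U₁^uU₀})^j_b = u(b₋)(\overline{U₁U₀})^j_b u^{−1}(b₊), b ⊂ Ω^{(j)}» («The
     j-th order averages Ū^j transform as follows»); B9 p. 394 (3.20) «(3.17) = exp(−(1/2α)‖RD*A‖²)», (3.21) «ℛ =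
     Δ^η_U N(Q′), N(Q′) = {λ : Q′λ = 0}» (R the orthogonal projection onto ℛ), (3.23) «Δ^η_U = D^{η*}_U D^η_U», (3.24)
     «⟨λ, Q′*aQ′λ⟩ = Σ_{j=0}^k a_j Σ_{y∈Λ_j}(L^jη)^{d−2}|(Q′_j(U)λ)(y)|²», (3.25) «Rf = (I − G′Q′*(Q′G′²Q′*)^{−1}Q′G′)f»;
     B11 p. 305 (170) «⟨δA′, J⟩ = 0 for δA′ : Q(U_k)δA′ = 0, R(U_k)D^{η*}_{U_k}δA′ = 0, where J = η^{−2} Im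
     D^{η*}_{U_k}∂U_k», (171) «𝔓*(U_k)J = 0»; p. 307 (181) «U_k(V^v) = U_k(V)^{ṽ}, where ṽ is constant on blocks B^j(y),
     y ∈ Λ_j, and equal to v(y)» («For the minimal configurations in the axial gauge»).  READING [model; print-level
     structure, no estimate of Bałaban's is claimed]: (a′) the coarse gauge mode of items (4‴)/(4⁗) is the
     LINEARISATION of (70) — the averages transform under a fine gauge transformation by RESTRICTION to the coarse bond
     ends, which is exactly §7 (`contourSum_gauge`: the transported gauge mode telescopes along any contour) — while
     the axial-gauge line sum `Q₀` intertwines with the transported block MEAN `Q′` of (3.19); the difference is the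
     generator `Λ` (`Λ(D_Uλ) = Q′λ − λ|`), which VANISHES IDENTICALLY on fields in the block axial gauge (64)/(67)
     (legs = 1), where (124) is the line sum; minimisers in the axial gauge are gauge-covariant (181).  So with
     `U_{k+1}` in its first-level block axial gauge the averaging in `X = U_k − Q₁U_{k+1}` acts as the line sum and the
     words (a) do not arise.  (b′) The cost: axial representatives are `W′ = W − D_Uλ_W`, and on gauge modes the
     bare-Hessian defect is `K₀(D_Uλ) = L²Q₀([J_f, λ]) − [J_c, Q′λ]` — CURRENT WORDS, the off-shell gauge-variance of
     the Wilson Hessian (`H_U D_Uλ = [J(U), λ]`), present in any gauge; printed handles: `J = η^{−2}Im D*∂U_k` obeys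
     (170)–(171) (J ⊥ ker Q(U_k) ∩ {Landau}: a CONSTRAINT FORCE `Q(U_k)*μ` up to the gauge-fixing direction) and (10)
     (sup size `(L^jη)^{−3}`, weight 3 — insufficient alone, `onPrintedBudget` 0+1+0 < 2).  MECHANISM TO TEST NEXT
     [model hypothesis, NOT asserted]: the operator that belongs in `τ` is the Hessian of the LAGRANGIAN `A(U) −
     ⟨μ, Ū^k(U)⟩` at the constrained critical point, which annihilates `D_Uλ` exactly for every `λ` vanishing at the
     coarse base points (invariance of `A`, invariance of `Ū^k` under such `u` by (70), criticality by (170)–(171));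
     the fine current word `[Q*μ, λ]` is then cancelled by `−⟨μ, ∂²Ū^k⟩(D_Uλ, ·)` and only coarse-restricted gauge
     parameters survive — coarse gauge modes, handled by (181).  Toy protocol for the successor: solve `J_f = Q*μ`
     for the in-plane family (uniform current ⇒ uniform `μ`), add `−μ·∂²[Ū(15)∘(124)]` to `H_f` by finite differences
     of the toy's exact nonlinear averaging, the same at the coarse scale, and re-run the ψ-columns and `K(D_fλ)`.
     (c′) at first order the background enters linearly, so su(2)-valued backgrounds superpose over Lie-algebra
     components and the abelian-per-component tables are the general first-order answer; genuinely non-abelian words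
     carry ≥ 2 background factors, weight ≥ 4 [counting].  (X2′) d = 4, L = 3 (`…/g8/vec4_L3_*.out`, C-ne3p1-30):
     d = 4, L = 3 (c = 18), 'wilson' + (L) + Ū(15), comb A, EIGHT single-carrier profiles (off-shell f1: F₁₂ = φ+ψx₁,
     F₄₁ = φ+ψx₄, F₁₃ = φ+ψx₁, F₂₄ = φ+ψx₂; ON-shell f2: (F₁₂, F₃₂) = (φ+ψx₃, ψx₁), (F₃₁, F₄₁) = (φ+ψx₄, ψx₃), (F₁₃,
     F₂₃) = (φ+ψx₂, ψx₁), (F₂₄, F₁₄) = (φ+ψx₁, ψx₂)): NO weight-2/3 words — max|w2| ≤ 7.1e−5, max|(∇F)W| ≤ 7e−4,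
     max|F·∇W| ≤ 4e−4 against c = 18 (O(h²), h = 1e−3); structure probe (2 profiles): legs(V) + d_cΛ(V) ≤ 6e−4,
     H_c(legs W) = ψ-column 9.0001 = c/2 on the off-shell profile and ≤ 4e−4 on the on-shell one; Ward control ≤
     1.8e−15 on-shell incl. f2 at ψ = 0.07 (= the current 8.5e−2 / 8.4e−3 on f1 at ψ = 0.07 / 0.007); gauge control ≤
     2.0e−15; outputs `g8/vec4_L3_f1.out` ba4c3e38f6a1ce64, `vec4_L3_f2.out` 19d71e1db5ac81e6, `vec4_L3_f1b.out`
     3e31263ed193a089, `vec4_L3_f2b.out` 4e80484c0acc77ee, `probe_legs_d4_L3.out` b1f875bb6ef60eb5 — d = 4 now clean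
     at L = 2 (36 profiles) and L = 3 (8 profiles).
 (4⁗″) THE LAGRANGIAN-HESSIAN TEST OF ITEM (4⁗′), RUN (v1.7; toys `…/g8/toy_lagr.py` (8df89c0b95454646),
     `lagr_check.py` (e8fc26da4b522cac), `lagr_check2.py` (2ab2a54f151780aa); MODEL as in items (4‴)/(4⁗)).  `T :=
     μ·d²C(U)[W, ·]` with `C` = B7 (15) computed exactly in SU(2) over the contours of (124), `μ` the Cartan-valued
     multiplier fixed by criticality of `A(U) − ⟨μ, C(U)⟩` in the Cartan directions — measured uniform along the
     carrier, `m_f = −(L^{d−1}/2)ψ`, `m_c = −(L^{d+2}/2)ψ`, consistent between the scales (`L²J_f = dC_f*J_c`), zero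
     on the on-shell family.  (Y1) [calculus identity — invariance of `A`, covariance (70), criticality — confirmed]
     for `λ` VANISHING AT THE COARSE LATTICE SITES, `max|(H_f − T_f)D_fλ|` = 8.3e−8 (ψ = 0.007), 8.4e−11 (ψ = 7e−4)
     against the bare word 7.9e−3, 7.9e−4, in d = 2 (L = 2, 3, 4) and d = 3 (L = 2).  (Y2) for `λ` with vanishing
     transported BLOCK MEANS `Q′λ = 0` — the linearisation of B7 (81), = B9 (3.21) `N(Q′)` — the residual keeps the
     bare size: ratio 0.88, 0.94, 1.43–1.46 (d = 2, L = 2, 3, 4), 0.74 (d = 3, L = 2); generic `λ`: 0.87–1.32.  (Y3)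
     the operator swap `K^𝓛(W) := Qv(L²(H_f − T_f)W) − (H_c − T_c)(QvW)` has LARGE weight-3 ψ-words where `K^H` is
     clean — line sum: 14, 2, 4 (d = 2, L = 2, c = 4); 134.5, 8.9, 45.0 / 153.0, 9.0, 27.0 (L = 3, c = 18); 28.0
     (d = 3, L = 2) — growing like `m_c ∝ L^{d+2}`: the multiplier term does not intertwine with the averaging (for
     the nested constraint `Ū^{k+1} = Ū^k∘Ū` the fine multiplier term is `Qv*T_cQv + J_c·d²Ū`, not a local `T_f`);
     contour form: carrier rows vanish at L = 2 but not at L = 3, the coarse current-word probe is untouched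
     (2.0000 → 2.0000, 9.0001 → 9.004); on the on-shell family `K^𝓛 ≡ K^H`.  LOCATED PRINT [R]: B7 p. 30 (78)
     «(R̄₀v)(y) = (R(V₀)v)(y) = … = v(y) exp[i Σ_{x∈B(y)} L^{−d} (1/i) log v^{−1}(y)R(V₀(Γ_{y,x}))v(x)]», (79), (80)
     «(R̄₀u^{j+1})(x_{j+1}) = (R(Ū₀^j)R̄₀u^j)(x_{j+1})», (81) «(R̄₀u^k)(y) = 1, y ∈ Ω^{(k)}» («The additional
     conditions are» … «we will solve the equations (81) and we will determine u uniquely as a function of U₁»).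
     READING [model]: the Lagrangian route of item (4⁗′) is CLOSED for Bałaban's setting (its exact cancellation
     needs site-pinned residual gauge, which (81) is not, and in `τ` it is two-grid inconsistent); the consistent
     first-order pair remains (bare Wilson Hessians, line sum, `Ū` (15)) of items (4‴)/(4⁗); the fate of the
     current word `[J(U_k), λ]` is decided by the TEST SPACE — by (170)–(171) `J(U_k)` annihilates Bałaban's
     fluctuation space `ker Q(U_k) ∩ {Landau}`, which contains no gauge modes — so what remains is TYPING: that
     space, (170) as its defining orthogonality, and the statement that `τ`'s consumer pairs `τ` only with it (or
     with on-shell data, where `J = 0` and every first-order word vanishes identically).  No further operator-level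
     toy can decide this.
 (4⁗‴) CORRECTION — THE DEFECT ON GAUGE MODES (v1.8; toys `…/g8/toy_gm2.py`, `toy_gm.py`, `toy_bc.py`; MODEL as in
     items (4‴)/(4⁗)).  Items (4⁗′) (b′) and (4⁗″) carried the extrapolation «on gauge modes the bare-Hessian defect
     `K₀(D_Uλ) = L²Q₀([J_f, λ]) − [J_c, Q′λ]` is a CURRENT WORD» (nonzero, weight 3) and organised the residual
     around it (Lagrangian Hessian; test space).  MEASURED: (Z1) LINE SUM on smooth gauge modes `W = D_f(gauge·
     e^{iq·x})`, weight-resolved by central differences — `c[φ,q⁰]` (w2), `c[ψ,q⁰]` (w3), `c[φ,q_i]` (w3), `c[ψ,q_i]`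
     (w4) ALL vanish: d = 2 (L = 2 exactly; L = 3 ≤ 2.5e−3; L = 4 ≤ 4.8e−2 with the h²-scaling of the residual
     checked, ×9 at h = 3e−3), d = 3 (L = 2, 3), d = 4 (L = 2); (Z2) LINE SUM on the blockwise covariantly-constant
     gauge modes `ṽ(x) = R(U(Γ_{y(x),x}))^{−1}v(y(x))` — the class B11 (181) assigns to minimisers' responses to gauge
     changes of the data — `dK/dφ = dK/dψ = 0` to all orders in the coarse momentum of `v`, the fine and coarse
     current words being individually nonzero on off-shell profiles (−0.424−3.811i each at d = 2, 3, L = 2) and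
     CANCELLING; (Z3) CONTOUR: on smooth gauge modes w2 = w3 = 0, first word at weight 4 (`c[ψ, q_a] = ∓c/2`: 2, 9,
     24 at L = 2, 3, 4); on (181) modes weight-3 words from the legs (−0.398+0.026i, …) = the coarse gauge mode /
     current words of items (4‴)/(4⁗), absent in the block axial gauge.  HENCE [model]: the two current words of
     `K₀(D_Uλ)` CANCEL through weight 4 (reading: gauge invariance of the Wilson action at each level gives
     `H D_Uλ = [J, λ]`, the averaging intertwines gauge modes by (70), and at weight 3 the current is the single
     uniform word whose fine/coarse normalisations are matched by (15) — not by straight products, item (4″)); NO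
     first-order word remains in the line-sum form on ANY input (smooth sections: items (4‴)/(4⁗); gauge modes:
     here); EVERY first-order word of the covariant two-grid defect is in the LEG functional `Λ` of (124) posed
     outside the block axial gauge, i.e. it is (a′), structural by B7 (64)/(67) (legs trivial ⇒ (124) = line sum),
     (70), B11 (181).  The Lagrangian sub-line of item (4⁗″) is closed AND unnecessary, and its «test-space»
     formulation is superseded — nothing needs to be paired away.  What remains of (α′-op) for vectors is TYPING
     ONLY: U1a's `AvgOps` for 1-forms in the block axial gauge, B9's `Δ_k(U)`, `G_k(U)` with Thms 3.1/3.3 as named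
     facts, and the instantiation of the slice hypotheses of `T4DefectFluxForm.faceKernel_of_slices` — the stuck
     goal, unchanged.  [MODEL: abelian per Lie-algebra component, first order, uniform-current single-carrier
     backgrounds; no estimate of Bałaban's is claimed.]
 (5) (β) COVARIANTLY, EXACTLY (§3).  The one-dimensional flux identity of `T4TwoSpacingDefect`/`T4DefectFluxForm` holds
     for ARBITRARY non-commuting link variables with two-sided inverses — no smallness, no abelianness: at `L = 2`,
     `Q^Σ(4Δ_u f) − Δ_U(Q^Σf) = U·g(j+1) − g(j)` with `U = u_{2j}u_{2j+1}` the straight coarse link, `Q^Σ` the block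
     SUM transported to the block corner and `g` = minus the covariant forward third difference based at `2j − 2`, read
     at `2j` (`cov_flux_identity_two`, an identity in the free ring on the window's letters modulo `uv = vu = 1`), and
     at `L = 3` with the stencil `−{1, 4, 1}` on transported third differences (`cov_flux_identity_three`);
     [script `…/g8/cov1d_general.py`, free-algebra expansion, exact integers] the same for `L = 2,…,6` with the
     closed-form stencil `w_m = C(min(m, 2L−4−m)+3, 3)` of `T4DefectFluxForm` (based at `Lj − L`) — which ALSO certifies
     the flat closed form of `R_L` at operator level for `L ≤ 6`.  Dictionary: a one-dimensional connection is pure gauge on a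
     line, so this is the flat identity conjugated by the transport to the block corner; on the torus circle the
     Polyakov phase is invisible at window level.  The commutator that (β) DOES produce in `d ≥ 2` —
     `[T₁ − 1, T₂ + S₂ − 2] = [(H − 1)T₂ + S₂(H⁻¹ − 1)]·T₁` (`beta_commutator`) — is weight 3 acting on the propagated
     function but enters the defect only under `∇²G_f` and one coarse divergence: weight ≥ 4, on budget regardless of
     centring.
 (6) (γ) (§4, normed ring).  `X = HY`, `‖Y‖ ≤ 1` ⟹ `‖X − Y‖ ≤ ‖H − 1‖`, telescoped along a chain of plaquette moves
     (`transport_compare`, `transport_chain`): comparing the two comb orders / two-path transports costs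
     `Σ‖H_i − 1‖ = O(L²)·α₀η²` per block with NO derivative on the propagated function only where it multiplies a full
     one-dimensional DEFECT (weight 4 already): on budget regardless.
 (7) THE HÖLDER BUDGET (§6, real arithmetic, v1.1).  Which curvature differences are printed decides the currency of
     (F4): B11 (10) prints the Maxwell combinations `|∂^{η*}∂^ηA|, |Δ^ηA| < B₃Mε₁(Lʲη)^{−3}` (Lipschitz scale); a GENERAL
     difference of the curvature is printed only through the Hölder clause of (9), `‖A‖_{1,β} < B₄(β₀)Mε₁(Lʲη)^{−2−β}`,
     `β ≤ β₀` — by reference to B8 (1.36) with `β₀ < 1` (the cell's row G-B11-F3 flags the printed endpoint `β₀ = 1` as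
     unsourced).  A weight-4 word carrying a Hölder-`β` curvature difference is sized `×(L^{1−β})^k` against the
     multiplier scale: clause (F4_β) of `FluxSizedHolder`.  The chain is ROBUST to it: `FluxSizedHolder … β` + the same
     readings ⟹ `OneStepCorrectionRate … (L^{−a})` and `NE3Shape R C (L^{−a})` for every `0 < a < β ≤ 1`, constant
     `β^{−2}c₂(a/β)` in place of `c₂(a)` (`log_sq_holder_le_rpow` = `one_add_mul_log_sq_mul_pow_le_rpow` at the base
     `L^β`; `flux_clause1_holder`, `oneStepCorrectionRate_of_fluxHolder_rpow`, `…_of_fluxSizedHolder_rpow`,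
     `ne3Shape_of_fluxSizedHolder_rpow`; `β = 1` is `FluxSized`, `fluxSizedHolder_one_iff`, `fluxSizedHolder_of_fluxSized`).
     Since every `a < 1` admits a `β ∈ ]a, 1[`, a Hölder input for EVERY `β₀ < 1` still gives the shape at every `a < 1`.

## Dictionary (readings of located print; [model] sentences are never hypotheses)

* Covariant shifts `(T_μf)(x) = U(x, x+e_μ)f(x+e_μ)`, `S_μ = T_μ⁻¹`, plaquette relation `T₁T₂ = H₁₂·T₂T₁` with `H₁₂` =
  multiplication by the plaquette holonomy based at `x` (`‖H − 1‖ = O(Mα₀(Lʲη)^{−2})·(lattice spacing)²` in the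
  regime of B9 (3.35) — in η-lattice units at the top scale, `α₀η²`); `S₂(H − 1)T₂` = the holonomy field translated
  by `−e₂` and conjugated by the link = its covariant translate, so `(H − 1) − S₂(H − 1)T₂` is a covariant DIFFERENCE
  of the curvature (size `α₀η³` if the background's curvature is Lipschitz on the unit scale — for B11's backgrounds a
  reading of B11 (9)–(10)/B9 (3.35), flagged NOT LOCATED at the level of `∇F`).
* Comb mean (CMP 95 (1.6)–(1.7), B7 (2), B9 (3.18)–(3.19)): `Q = q_d ∘ ⋯ ∘ q_1` with `q_ν = L⁻¹Σ_{t<L}T_ν^t` on the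
  lattice already averaged in directions `< ν`; `m₁(q_ν) = (L − 1)/2` per unit weight, `L(L−1)/2` for block sums.
* Weights: `|u| ~ η⁻²λ̂`, `|∇u| ~ η⁻¹λ̂`, `|∇²u| ~ λ̂` (the slice walls (F2)(F3)(F5) of `FluxSized` in the (115)
  currency), `‖G_c‖_{∞→∞} ~ η⁻²`, `‖G_c∂*‖ ~ η⁻¹` (B9 Thms 3.1/3.3, per slice), curvature `α₀η²`, its difference
  `α₀η³`: a bulk word with one curvature and `m` leftmost coarse divergences, `r` differences on the curvature, `s` on
  `u` gives `z ~ α₀η^{m+r+s−2}λ̂`; (F4) ⟺ `m + r + s ≥ 2` ⟺ weight `w = 2 + m + r + s ≥ 4`.  PRINTED refinement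
  (v1.1): on the lattice `|∇^rF| ≤ 2^{r−1}sup|∇F|`, and no curvature difference beyond the first is printed at its
  scale, so `r` gains at most one: printed budget ⟺ `m + min(r,1) + s ≥ 2` (`onPrintedBudget`; (0,2,0) is the one
  formal-weight-4 word off it); a first difference that is only Hölder-`β` gains `β`: clause (F4_β), item (7).
* Vector averaging [located shape, B7 (14) p. 19; B9 (3.3)–(3.5), (3.13)–(3.15) pp. 391–393]: walking `Γ_{c,x}` from
  `y`, a bond `⟨z, z+e_μ⟩` met forwards contributes `+P(y←z)·W_μ(z)`, met backwards `−P(y←z via z+e_μ)·W_μ(z)`, the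
  transport updating by the link (`P_{k+1} = P_kℓ_k`) resp. its inverse (`P_{k+1}ℓ = P_k`); the linearised gauge mode
  is `W_μ(z) = ℓ_μ(z)λ(z+e_μ) − λ(z)` ((3.3)); normalisation `L^{−(d+1)}` per bond ((14)).  The remaining terms of (124)
  are `O(curvature)·A` without a derivative [B7 p. 36: «small because the functions … are equal to 1 for z = 0»]:
  weight 2 inside `Q`, hence weight ≥ 4 inside the defect by the budget above [model].
* Which pair: the compensation (4) concerns the pair (fine background `W`, coarse background `Ū(W)` = its B7 average);
  replacing `Ū(W)` by the actual coarse minimiser is a background VARIATION, i.e. the stability side (T2)/(F2) of the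
  lineage's factorisation, not a consistency remainder [dictionary].

## Honest framing

Finite-T⁴ ultraviolet bookkeeping about MINIMISERS (rung (B)+1 of the cell's ladder); no conditional (`BetaPertH`,
(B), (B^μ)) enters; nothing here bears on infinite volume, a mass gap, or the Clay problem.  No `sorry`, no axioms
beyond Mathlib's; every kernel statement is ring algebra / a norm inequality / real arithmetic [folklore]; every
[model] / reading / [toy] sentence is dictionary or evidence, never a hypothesis discharged by citation; the manuscripts
under audit are quoted for their DEFINITIONS ((1.6)–(1.8), (2), (14), (15), (58)–(62), (124)'s shape, (3.3)–(3.5), (3.10),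
(3.13)–(3.19), (3.20)–(3.25), (3.35); B7 (64), (67), (70), (78)–(81); B11 Thm 1 (9)–(10), (170)–(171), (181) as statements), never for a disputed step.  What is NOT obtained: the compensation (α′) for Bałaban's VECTOR
small-field operators and non-abelian `Ū` (the abelian scalar model certifies it at first order for d ≤ 4, item (4′);
the d = 2 vector model locates its residue in the channels (G)/(M) of the RG-defined forms, item (4″); with the
exact Wilson Hessian and B7's axial-gauge line sum `Q₀` the d = 2 model is CLEAN at first order and the full-contour
form differs by a coarse gauge mode + an off-shell current word, item (4‴) — gauge bookkeeping of the chain and the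
current word vs B11 (10) are the located residue; the same in d = 3, 4, where B9 (3.15) fixes the chain's averaging
as the contour form, so the chain's first-order residue IS the coarse gauge mode + the coarse current word, item
(4⁗); the former is the linearised B7 (70) and absent in the block axial gauge, the latter the off-shell
gauge-variance `[J, λ]` of the bare Hessian with `J` a constraint force (B11 (170)–(171)) — the Lagrangian-Hessian
test is next, item (4⁗′); RUN in item (4⁗″): exact only for site-pinned residual gauge, not for Bałaban's (81),
and two-grid inconsistent as an operator swap — route closed, the current word is a test-space / typing matter,
B11 (170)–(171); CORRECTED in item (4⁗‴): on gauge modes the line-sum defect has NO word through weight 4 — the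
current words cancel — so every first-order word is in the legs of (124), structural, and the residual is typing
only); a located Lipschitz bound on GENERAL
differences of the background curvature (only the Maxwell combinations, B11 (10); general ones Hölder, (9), G-B11-F3);
anything on (W2) proper.  Records: `t4/T4-EST-U1b-OSC.md` v1.18 (RESULTS 17–25), `t4/T4-EST-NE3-P1.md` v2.16, GAPS
G-ne3p1-25 … 32 / C-ne3p1-26 … 32 of the cell `pub-balaban`.

## Located print ([R] = read on the page image this generation; «…» verbatim)

* [R] CMP 95 (`paper:balaban1984-cmp95-propagators-rt-i`, Bałaban, Propagators and renormalization transformations I),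
  p. 18 (1.6): «B(y) = {x ∈ T₁ : y_μ ≤ x_μ < y_μ + L, μ = 1, …, d}, y ∈ T_L^{(1)}» (CORNER-anchored blocks); (1.7):
  «Γ_{y,x} = [y, (y₁, …, y_{d−1}, x_d)] ∪ … ∪ [(y₁, …, y_μ, x_{μ+1}, …, x_d), (y₁, …, x_μ, x_{μ+1}, …, x_d)] ∪ … ∪
  [(y₁, x₂, …, x_d), x]» (the COMB: direction d first, direction 1 last); p. 19 (1.8): «B_c = Σ_{x∈B(c₋)}
  L^{−(d+1)}(A(Γ_{c₋,x}) + A([x, x(c)]) + A(Γ_{x(c),c₊})), c = ⟨c₋, c₊⟩ ⊂ T_L^{(1)}» (the comb legs ARE in the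
  average), (1.9) «B^λ_c = B_c − L^{−1}(λ(c₊) − λ(c₋)) = B_c − (∂λ)(c)», (1.11) «(QA)_c = Σ_{x∈B(c₋)}
  L^{−(d+1)}A([x, x(c)])» (axial gauge `A(Γ_{y,x}) = 0`).
* [R] B7 (`paper:balaban1985-cmp98-averaging`, CMP 98 (1985) 17–51), p. 17 (2): «B^j(y) = {x ∈ … : y_μ ≤ x_μ < y_μ +
  L^nη, μ = 1, …, d}»; p. 19 (14): «Ā_c = Σ_{x∈B(c₋)} L^{−(d+1)}(A(Γ_{c₋,x}) + A([x, x(c)]) + A(Γ_{x(c),c₊}))», (15):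
  «Ū_c = exp[i Σ_{x∈B(c₋)} L^{−d} (1/i) log U(Γ_{c,x})U(c)^{−1}] U(c)», and «Γ_{c₋,x} ∪ [x, x(c)] ∪ Γ_{x(c),c₊} is an
  oriented contour with c₋ as an initial point and c₊ as a final point. We denote it by Γ_{c,x}.» — `Θ_c := Ū_cU(c)⁻¹`
  is the printed excess factor of (4).  [R] p. 29 (64) «(R_{0,y}U′)(Γ_{y,x}) = 1, x ∈ B(y), x ≠ y, y ∈ Ω^{(1)}», (67)
  «(R̄^j_{0,y}Ũ′^j)(Γ_{y,x}) = 1, x ∈ B(y), x ≠ y, y ∈ Ω^{(j+1)}», (70) «Ū^j_b = (\overline{U₁^uU₀})^j_b =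
  u(b₋)(\overline{U₁U₀})^j_b u^{−1}(b₊), b ⊂ Ω^{(j)}» — block axial gauges and the transformation law of the averages.
  [R] p. 30 (78) «(R̄₀v)(y) = (R(V₀)v)(y) = {(R(V₀)v)(x)}_{x∈B(y)} = v(y) exp[i Σ_{x∈B(y)} L^{−d} (1/i) log
  v^{−1}(y)R(V₀(Γ_{y,x}))v(x)]», (79) «(R̄₀u)(x₁) = (R(U₀)u)(x₁), x₁ ∈ Ω^{(1)}», (80) «(R̄₀u^{j+1})(x_{j+1}) =
  (R(Ū₀^j)R̄₀u^j)(x_{j+1}), x_{j+1} ∈ Ω^{(j+1)}», (81) «(R̄₀u^k)(y) = 1, y ∈ Ω^{(k)}» — the residual gauge is fixed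
  through the k-fold AVERAGES of u, not its site values.
* [R] B9 (`paper:balaban1985-cmp99-background-propagators`) p. 393 (3.15): «Q_j(U) = Q(Ū^{j−1})·…·Q(Ū)Q(U), where
  Q(V) is given by the explicit formula (124) in [5]», (3.17) (the gauge-fixing density with δ(Q′λ), «A^λ = A − Dλ»),
  (3.18)–(3.19) (the comb averaging with the contours of (1.7): «(Q′(V)λ)(y) = Σ_{x∈B(y)} L^{−d}R(V(Γ_{y,x}))λ(x)»;
  certified quotation in `B9Thm37GlueTorusCov`), p. 396 (3.35): «|A| < O(1)Mα₀(L^jη)^{−1}, |∇^ηA| <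
  O(1)Mα₀(L^jη)^{−2} on □, where O(1)M is a size of □ in T_{L^{−j}}» (the span certified in `T4SliceTelescoping`)
  — the size of `H − 1`.  [R] p. 394 (3.20) «(3.17) = exp(−(1/2α)‖RD*A‖²)», (3.21) «ℛ = Δ^η_U N(Q′), N(Q′) = {λ :
  Q′λ = 0}», (3.22), (3.23) «Δ^η_U = D^{η*}_U D^η_U», (3.24) «⟨λ, Q′*aQ′λ⟩ = Σ_{j=0}^k a_j Σ_{y∈Λ_j}(L^jη)^{d−2}
  |(Q′_j(U)λ)(y)|²», (3.25) «Rf = (I − G′Q′*(Q′G′²Q′*)^{−1}Q′G′)f» — what the fluctuation gauge fixing fixes.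
* [R] B11 (`paper:balaban1985-cmp102-variational-background`, CMP 102 (1985) 277–309) p. 279, Theorem 1: (9) «U^{u^{−1}}
  = e^{iηA}, |A| < B₃Mε₁(Lʲη)^{−1}, |∇^ηA| < B₃Mε₁(Lʲη)^{−2}, ‖A‖_{1,β} < B₄(β₀)Mε₁(Lʲη)^{−2−β} for 0 ≤ β ≤ β₀ = 1,»
  and (10) «|∂^{η*}∂^ηA|, |Δ^ηA| < B₃Mε₁(Lʲη)^{−3}» on cubes □ of size 2MLʲη in the local regular gauge u — the
  Maxwell combinations of the second differences of A at the Lipschitz scale; the Hölder clause is the cell's row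
  G-B11-F3 (endpoint `β₀ = 1` unsourced; `β < 1` by reference to B8 (1.36)).  [corpus: `paper:balaban1983-cmp89-
  regularity-decay` p. 573 (1.9): Hölder-α, `α < 1`, for first covariant differences of `G_k(Ω, A)f` — the series'
  regularity technology is `C^{1,α}`, α < 1.]  [R] p. 305 (170) «⟨δA′, J⟩ = 0 for δA′ : Q(U_k)δA′ = 0,
  R(U_k)D^{η*}_{U_k}δA′ = 0, where J = η^{−2} Im D^{η*}_{U_k}∂U_k», (171) «𝔓*(U_k)J = 0»; p. 307 (181) «U_k(V^v) =
  U_k(V)^{ṽ}, where ṽ is constant on blocks B^j(y), y ∈ Λ_j, and equal to v(y)» (minimal configurations in the axial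
  gauge) — the minimiser's current is a constraint force; minimisers are gauge-covariant.
* [toy; `…/g8/toy_covdefect_var.py`, `…/g8/toy_covdefect_d.py` (+ `--w4`), pure python, 1 core, ≤ 30 s per table]
  general d, B7 (15) exactly (`Ū_c = exp[i·mean_x arg(U(Γ_{c,x})U(c)⁻¹)]·U(c)`), backgrounds `u_b(x) = exp(i x_a(φ +
  ψx_g))` (g ∉ {a,b}) / `exp(iθ(x_a))`, `θ(t) = φt + ψt(t−1)/2` (g = a), sections `e^{−ix_b·phase}e^{ip·x}`, central
  differences `h = 10⁻³` at 0: `|∂K/∂φ|, |∂K/∂ψ|, max_i|∂²K/∂φ∂p_i|` — straight: (0, L²(L−1)/2 or 0, L²(L−1)); avg15: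
  worst 1.2·10⁻⁵ / 1.1·10⁻⁴ / 0 over 48 rows (d = 3, L = 2, 3), 2.0·10⁻⁶ over 72 rows (d = 4, L = 2), 0 in d = 2
  (L ≤ 5; centred blocks 0 in all modes); `∂²K/∂ψ∂p_i` (avg15): `c(L)·[g = a ∧ i = b]`, c = 1.000 (L = 2; d = 3, 4),
  6.000 (L = 3, d = 3), all other entries 0.000 (straight: ±1, ±2 / ±9, ±18 incl. transverse).
* [toy; `…/g8/toy_alias.py` (d = 2, single-plaquette fluxes), `…/g8/toy_alias_d.py`, `…/g8/toy_alias_mom3.py` (general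
  d, single-LINK responses of the gauge-invariant scalar `K[U]u₀(0)`, `u₀` = comb-transported constant section),
  ≤ 90 s] avg15: moments of order ≤ 2 of the link functional ≤ 2.8·10⁻⁸ and `max_{ξ ∈ (2π/L)ℤ^d∖0}|k̂(ξ)|` ≤ 3.5·10⁻⁹
  for (d, L) = (2,2), (2,3), (3,2), (3,3), (4,2), (4,3), both comb orders (support up to 1110 links, `|k|₁` up to 99.2;
  straight: second moments `L²(L−1)`, aliasing values also 0); d = 4, L = 2: every third moment ≤ 10⁻⁶.
* [toy; `t4/b2b-balaban-t4-ne3-p1/g8/toy_covdefect.py`, pure python complex floats, 1 core, 0.06 s] d = 2, U(1), Landau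
  gauge `u₁ ≡ 1`, `u₂(x) = e^{iφx₁}` (constant curvature φ), section `u = e^{−iφx₁x₂}e^{ip·x}`, `(Ku)(0) = Q(L²Δ_fu) −
  Δ_c(Qu)`, mixed differences `h = 10⁻³`: straight coarse links, corner comb: `∂²K/∂φ∂p₁ = L²(L−1)` = 4.000, 18.000,
  48.000, 100.000 and `∂²K/∂φ∂p₂ = −L²(L−1)` (L = 2, 3, 4, 5; comb orders q₂q₁ and q₁q₂ agree); comb-AVERAGED coarse
  links ((1.8)/(15)-type, U(1)-projected mean): |coefficient| ≤ 2·10⁻³ in both; centred blocks (L = 3, 5): 0 in all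
  modes; `∂K/∂φ` at `p = 0`: 0 in every mode (no weight-2 term).
* [script; `…/g8/cov1d_check.py`, `…/g8/cov1d_general.py`, free ring with letters `u_i, v_i, f_i` modulo `u_iv_i =
  v_iu_i = 1`, exact integers, < 1 s] the covariant one-dimensional flux identity for block sums, `L = 2, …, 6`, with
  the closed-form stencil based at `Lj − L`: residual 0.
-/

noncomputable section

open Finset

namespace Literature.MathematicalPhysics.QuantumFieldTheory.Balaban1983to89.T4CovariantDefectAlgebra

open Literature.MathematicalPhysics.QuantumFieldTheory.Balaban1983to89.T4DefectFluxForm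
open Literature.MathematicalPhysics.QuantumFieldTheory.Balaban1983to89.T4OneStepFactorisation
open Literature.MathematicalPhysics.QuantumFieldTheory.Balaban1983to89.T4EtaRateMin
open Literature.MathematicalPhysics.QuantumFieldTheory.Balaban1983to89.T4FixedPointResponse

/-! ## §1  Non-commutative flux expansion: main term + fine crossings + coarse crossings (exact, any ring) -/
section DefectSplit

variable {R : Type*} [Ring R]

/-- **The split at one direction.**  `P = T·q·D` (transverse means applied after / the switched mean / transverse means
applied before):  `P·a − b·P = T(qa − bq)D + Tq·[D, a] + [T, b]·qD` — main term, FINE crossing (the fine Laplacian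
crosses the inner means), COARSE crossing (the coarse Laplacian crosses the outer means). [folklore] -/
theorem defect_split (T q D a b : R) :
    T * q * D * a - b * (T * q * D)
      = T * (q * a - b * q) * D + T * q * (D * a - a * D) + (T * b - b * T) * q * D := by
  noncomm_ring

/-- **Summed over directions** with a splitting `P = T_μq_μD_μ` per direction: the covariant analogue of
`T4DefectFluxForm.defect_product_two/_list` with the two crossing sums displayed. [folklore] -/
theorem defect_split_sum {ι : Type*} (s : Finset ι) (P : R) (T q D a b : ι → R)
    (hP : ∀ μ ∈ s, T μ * q μ * D μ = P) :
    P * (∑ μ ∈ s, a μ) - (∑ μ ∈ s, b μ) * P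
      = ∑ μ ∈ s, (T μ * (q μ * a μ - b μ * q μ) * D μ + T μ * q μ * (D μ * a μ - a μ * D μ)
          + (T μ * b μ - b μ * T μ) * q μ * D μ) := by
  rw [Finset.mul_sum, Finset.sum_mul, ← Finset.sum_sub_distrib]
  refine Finset.sum_congr rfl fun μ hμ => ?_
  rw [← hP μ hμ]
  exact defect_split _ _ _ _ _

/-- **Compensated coarse Laplacians.**  If each coarse one-dimensional Laplacian is `b₀_μ + θ_μ` (straight product +
the excess of the AVERAGED coarse background, B7 (15)), the defect is the straight expansion minus `(Σθ)·P`: the term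
against which the first-moment crossings of §2 must compensate. [folklore] -/
theorem defect_split_sum_compensated {ι : Type*} (s : Finset ι) (P : R) (T q D a b₀ θ : ι → R)
    (hP : ∀ μ ∈ s, T μ * q μ * D μ = P) :
    P * (∑ μ ∈ s, a μ) - (∑ μ ∈ s, (b₀ μ + θ μ)) * P
      = ∑ μ ∈ s, (T μ * (q μ * a μ - b₀ μ * q μ) * D μ + T μ * q μ * (D μ * a μ - a μ * D μ)
          + (T μ * b₀ μ - b₀ μ * T μ) * q μ * D μ) - (∑ μ ∈ s, θ μ) * P := by
  rw [← defect_split_sum s P T q D a b₀ hP, Finset.sum_add_distrib]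
  noncomm_ring

variable {ι : Type*}

/-- Main part of the list expansion: `Σ_i T_{<i}·(q_ia_i − b_iq_i)·D_{>i}` with `T_{<i}` the product of the means
listed before position `i` (applied after) and `D_{>i}` of those listed after — by recursion on the list. [folklore] -/
def splitMain (q a b : ι → R) : List ι → R
  | [] => 0
  | μ :: l => (q μ * a μ - b μ * q μ) * (l.map q).prod + q μ * splitMain q a b l

/-- Fine crossings: `Σ_i T_{≤i}·[D_{>i}, a_i]`. [folklore] -/
def splitFine (q a : ι → R) : List ι → R
  | [] => 0
  | μ :: l => q μ * ((l.map q).prod * a μ - a μ * (l.map q).prod) + q μ * splitFine q a l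

/-- Coarse crossings: `Σ_i [q_i, Σ_{j>i} b_j]·D_{>i}` (each coarse Laplacian crossing the means listed before it).
[folklore] -/
def splitCoarse (q b : ι → R) : List ι → R
  | [] => 0
  | μ :: l => (q μ * (l.map b).sum - (l.map b).sum * q μ) * (l.map q).prod + q μ * splitCoarse q b l

/-- Recursion, empty list. [folklore] -/
@[simp] theorem splitMain_nil (q a b : ι → R) : splitMain q a b [] = 0 := rfl
/-- Recursion, empty list. [folklore] -/
@[simp] theorem splitFine_nil (q a : ι → R) : splitFine q a [] = 0 := rfl
/-- Recursion, empty list. [folklore] -/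
@[simp] theorem splitCoarse_nil (q b : ι → R) : splitCoarse q b [] = 0 := rfl
/-- Recursion step: `main(μ :: l) = (q_μa_μ − b_μq_μ)·∏_l q + q_μ·main(l)`. [folklore] -/
theorem splitMain_cons (q a b : ι → R) (μ : ι) (l : List ι) :
    splitMain q a b (μ :: l) = (q μ * a μ - b μ * q μ) * (l.map q).prod + q μ * splitMain q a b l := rfl
/-- Recursion step: `fine(μ :: l) = q_μ·[∏_l q, a_μ] + q_μ·fine(l)`. [folklore] -/
theorem splitFine_cons (q a : ι → R) (μ : ι) (l : List ι) :
    splitFine q a (μ :: l) = q μ * ((l.map q).prod * a μ - a μ * (l.map q).prod) + q μ * splitFine q a l := rfl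
/-- Recursion step: `coarse(μ :: l) = [q_μ, Σ_l b]·∏_l q + q_μ·coarse(l)`. [folklore] -/
theorem splitCoarse_cons (q b : ι → R) (μ : ι) (l : List ι) :
    splitCoarse q b (μ :: l)
      = (q μ * (l.map b).sum - (l.map b).sum * q μ) * (l.map q).prod + q μ * splitCoarse q b l := rfl

/-- **Non-commutative flux expansion, any number of directions, NO hypothesis.**  For an ordered `List` product of
means and sums of Laplacians:  `(∏ q)·(Σ a) − (Σ b)·(∏ q) = splitMain + splitFine + splitCoarse`. [folklore] -/
theorem defect_split_list (q a b : ι → R) : ∀ l : List ι,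
    (l.map q).prod * (l.map a).sum - (l.map b).sum * (l.map q).prod
      = splitMain q a b l + splitFine q a l + splitCoarse q b l
  | [] => by simp
  | μ :: l => by
      have ih := defect_split_list q a b l
      rw [splitMain_cons, splitFine_cons, splitCoarse_cons]
      simp only [List.map_cons, List.prod_cons, List.sum_cons]
      have e : q μ * (l.map q).prod * (a μ + (l.map a).sum) - (b μ + (l.map b).sum) * (q μ * (l.map q).prod)
          = (q μ * a μ - b μ * q μ) * (l.map q).prod
            + q μ * ((l.map q).prod * a μ - a μ * (l.map q).prod)
            + (q μ * (l.map b).sum - (l.map b).sum * q μ) * (l.map q).prod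
            + q μ * ((l.map q).prod * (l.map a).sum - (l.map b).sum * (l.map q).prod) := by
        noncomm_ring
      rw [e, ih]
      noncomm_ring

/-- **Commuting case.**  If every fine Laplacian commutes with the means listed AFTER its direction and every coarse
one with the means listed BEFORE it, both crossing sums vanish and the defect is `splitMain` — the flux-form structure
of `T4DefectFluxForm` (there under pairwise commutation of the means). [folklore] -/
theorem defect_split_list_of_comm (q a b : ι → R) : ∀ l : List ι,
    (∀ μ, ∀ l₁ l₂ : List ι, l = l₁ ++ μ :: l₂ → (l₂.map q).prod * a μ = a μ * (l₂.map q).prod) →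
    (∀ μ, ∀ l₁ l₂ : List ι, l = l₁ ++ μ :: l₂ → q μ * (l₂.map b).sum = (l₂.map b).sum * q μ) →
      (l.map q).prod * (l.map a).sum - (l.map b).sum * (l.map q).prod = splitMain q a b l
  | [], _, _ => by simp
  | μ :: l, ha, hb => by
      have ha' : ∀ ν, ∀ l₁ l₂ : List ι, l = l₁ ++ ν :: l₂ → (l₂.map q).prod * a ν = a ν * (l₂.map q).prod :=
        fun ν l₁ l₂ h => ha ν (μ :: l₁) l₂ (by rw [h]; rfl)
      have hb' : ∀ ν, ∀ l₁ l₂ : List ι, l = l₁ ++ ν :: l₂ → q ν * (l₂.map b).sum = (l₂.map b).sum * q ν :=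
        fun ν l₁ l₂ h => hb ν (μ :: l₁) l₂ (by rw [h]; rfl)
      have ih := defect_split_list_of_comm q a b l ha' hb'
      have h0a : (l.map q).prod * a μ = a μ * (l.map q).prod := ha μ [] l rfl
      have h0b : q μ * (l.map b).sum = (l.map b).sum * q μ := hb μ [] l rfl
      rw [splitMain_cons, ← ih]
      simp only [List.map_cons, List.prod_cons, List.sum_cons]
      have e : q μ * (l.map q).prod * (a μ + (l.map a).sum) - (b μ + (l.map b).sum) * (q μ * (l.map q).prod)
          = (q μ * a μ - b μ * q μ) * (l.map q).prod
            + q μ * ((l.map q).prod * a μ - a μ * (l.map q).prod)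
            + (q μ * (l.map b).sum - (l.map b).sum * q μ) * (l.map q).prod
            + q μ * ((l.map q).prod * (l.map a).sum - (l.map b).sum * (l.map q).prod) := by
        noncomm_ring
      rw [e, h0a, h0b, sub_self, sub_self, mul_zero, zero_mul, add_zero, add_zero]

/-- The case of interest `d = 4`, four comb factors in Bałaban's order `q₄ ∘ q₃ ∘ q₂ ∘ q₁` (CMP 95 (1.7): direction d
first): the expansion with both crossing sums, no hypothesis. -/
example (q a b : Fin 4 → R) :
    ((List.finRange 4).map q).prod * ((List.finRange 4).map a).sum
        - ((List.finRange 4).map b).sum * ((List.finRange 4).map q).prod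
      = splitMain q a b (List.finRange 4) + splitFine q a (List.finRange 4) + splitCoarse q b (List.finRange 4) :=
  defect_split_list q a b _

end DefectSplit

/-! ## §2  Crossing calculus: one commutator = one curvature factor; stencils cross with their FIRST MOMENT -/
section Crossing

variable {R : Type*} [Ring R]

/-- Remainder `A_t` of the crossing of `T^t` (multiplied on the left by `T − 1`):  `A₀ = 0`,
`A_{t+1} = (G_t·E + A_t)·T`, `G_t = Σ_{j<t} T^j`. [folklore] -/
def crossA (T E : R) : ℕ → R
  | 0 => 0
  | t + 1 => ((∑ j ∈ Finset.range t, T ^ j) * E + crossA T E t) * T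

/-- Remainder `B_t` (multiplied on the right by `T − 1`):  `B₀ = 0`, `B_{t+1} = (t+1)•E + B_t·T`. [folklore] -/
def crossB (T E : R) : ℕ → R
  | 0 => 0
  | t + 1 => (t + 1) • E + crossB T E t * T

/-- Recursion, `t = 0`. [folklore] -/
@[simp] theorem crossA_zero (T E : R) : crossA T E 0 = 0 := rfl
/-- Recursion, `t = 0`. [folklore] -/
@[simp] theorem crossB_zero (T E : R) : crossB T E 0 = 0 := rfl
/-- Recursion step of `crossA`. [folklore] -/
theorem crossA_succ (T E : R) (t : ℕ) :
    crossA T E (t + 1) = ((∑ j ∈ Finset.range t, T ^ j) * E + crossA T E t) * T := rfl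
/-- Recursion step of `crossB`. [folklore] -/
theorem crossB_succ (T E : R) (t : ℕ) : crossB T E (t + 1) = (t + 1) • E + crossB T E t * T := rfl

/-- **Crossing a power: the first-moment display.**  If `T·X − X·T = E·T` then
`T^t·X − X·T^t = t • E + (T − 1)·A_t + B_t·(T − 1)`:  `t` copies of the curvature datum `E` plus words carrying an
extra difference `T − 1` on the left (a divergence) or on the right (a difference of the argument). [folklore] -/
theorem crossing_moment (T X E : R) (hE : T * X - X * T = E * T) :
    ∀ t : ℕ, T ^ t * X - X * T ^ t = t • E + (T - 1) * crossA T E t + crossB T E t * (T - 1)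
  | 0 => by simp
  | t + 1 => by
      have ih := crossing_moment T X E hE t
      have step : T ^ (t + 1) * X - X * T ^ (t + 1) = T ^ t * (E * T) + (T ^ t * X - X * T ^ t) * T := by
        rw [← hE, pow_succ]; noncomm_ring
      have hTt : T ^ t = (T - 1) * (∑ j ∈ Finset.range t, T ^ j) + 1 := by
        rw [mul_geom_sum]; abel
      rw [step, ih, crossA_succ, crossB_succ, succ_nsmul]
      rw [hTt]
      generalize (∑ j ∈ Finset.range t, T ^ j) = G
      generalize crossA T E t = A
      generalize crossB T E t = B
      generalize t • E = c
      noncomm_ring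

/-- **Crossing a non-negative integer stencil** `q = Σ_{t<n} w_t • T^t`:
`q·X − X·q = m₁ • E + (T − 1)·A + B·(T − 1)` with `m₁ = Σ_t w_t·t` the FIRST MOMENT. [folklore] -/
theorem stencil_crossing (T X E : R) (hE : T * X - X * T = E * T) (w : ℕ → ℕ) (n : ℕ) :
    (∑ t ∈ Finset.range n, w t • T ^ t) * X - X * (∑ t ∈ Finset.range n, w t • T ^ t)
      = (∑ t ∈ Finset.range n, w t * t) • E + (T - 1) * (∑ t ∈ Finset.range n, w t • crossA T E t)
        + (∑ t ∈ Finset.range n, w t • crossB T E t) * (T - 1) := by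
  have key : ∀ t, (w t • T ^ t) * X - X * (w t • T ^ t)
      = (w t * t) • E + (T - 1) * (w t • crossA T E t) + (w t • crossB T E t) * (T - 1) := by
    intro t
    rw [smul_mul_assoc, mul_smul_comm, ← smul_sub, crossing_moment T X E hE t, smul_add, smul_add, smul_smul,
      mul_smul_comm, smul_mul_assoc]
  rw [Finset.sum_mul, Finset.mul_sum, ← Finset.sum_sub_distrib, Finset.sum_congr rfl fun t _ => key t,
    Finset.sum_add_distrib, Finset.sum_add_distrib, Finset.sum_smul, Finset.mul_sum, Finset.sum_mul]

/-- **Corner-anchored block sums** `Σ_{t<n} T^t` (B7 (2), CMP 95 (1.6): `y_μ ≤ x_μ < y_μ + L`): first moment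
`n(n − 1)/2`, NON-ZERO for `n ≥ 2`. [folklore] -/
theorem blockSum_crossing (T X E : R) (hE : T * X - X * T = E * T) (n : ℕ) :
    (∑ t ∈ Finset.range n, T ^ t) * X - X * (∑ t ∈ Finset.range n, T ^ t)
      = (n * (n - 1) / 2) • E + (T - 1) * (∑ t ∈ Finset.range n, crossA T E t)
        + (∑ t ∈ Finset.range n, crossB T E t) * (T - 1) := by
  have h := stencil_crossing T X E hE (fun _ => 1) n
  simp only [one_smul, one_mul] at h
  rw [h, Finset.sum_range_id]

/-- The first moments of the corner block sums at `L = 2, 3, 4, 5`: `1, 3, 6, 10` (`= L(L−1)/2`; per unit weight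
`(L − 1)/2`), against `0` for any centred stencil. -/
example : (∑ t ∈ Finset.range 2, t, ∑ t ∈ Finset.range 3, t, ∑ t ∈ Finset.range 4, t, ∑ t ∈ Finset.range 5, t)
    = (1, 3, 6, 10) := by decide

/-- **The plaquette relation is a definition, not a constraint.**  For shifts with two-sided inverses the
HOLONOMY `H := T₁T₂S₁S₂` (multiplication by the plaquette variable based at the site, in the lattice dictionary) and
`Hi := T₂T₁S₂S₁` satisfy `T₁T₂ = H·T₂T₁`, `Hi·H = 1`, `H·Hi = 1`: every hypothesis of this section is discharged by
invertibility; the CONTENT is the size of `H − 1` (B9 (3.35)). [folklore] -/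
theorem plaquette_relation_of_holonomy (T₁ T₂ S₁ S₂ : R) (h1 : T₁ * S₁ = 1) (h1' : S₁ * T₁ = 1)
    (h2 : T₂ * S₂ = 1) (h2' : S₂ * T₂ = 1) :
    T₁ * T₂ = (T₁ * T₂ * S₁ * S₂) * T₂ * T₁ ∧ (T₂ * T₁ * S₂ * S₁) * (T₁ * T₂ * S₁ * S₂) = 1
      ∧ (T₁ * T₂ * S₁ * S₂) * (T₂ * T₁ * S₂ * S₁) = 1 := by
  have h1x : ∀ x : R, T₁ * (S₁ * x) = x := fun x => by rw [← mul_assoc, h1, one_mul]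
  have h1x' : ∀ x : R, S₁ * (T₁ * x) = x := fun x => by rw [← mul_assoc, h1', one_mul]
  have h2x : ∀ x : R, T₂ * (S₂ * x) = x := fun x => by rw [← mul_assoc, h2, one_mul]
  have h2x' : ∀ x : R, S₂ * (T₂ * x) = x := fun x => by rw [← mul_assoc, h2', one_mul]
  refine ⟨?_, ?_, ?_⟩ <;> simp only [mul_assoc, h1, h1', h2, h2', h1x, h1x', h2x, h2x', mul_one]

/-- **Datum for the forward transverse shift.**  The plaquette relation `T₁T₂ = H·T₂T₁` gives
`T₁T₂ − T₂T₁ = [(H − 1)T₂]·T₁`: one commutator = one curvature factor. [folklore] -/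
theorem crossingDatum_fwd (T₁ T₂ H : R) (h : T₁ * T₂ = H * T₂ * T₁) :
    T₁ * T₂ - T₂ * T₁ = (H - 1) * T₂ * T₁ := by
  rw [h]; noncomm_ring

/-- The plaquette relation transported to the backward shift: `T₁S₂ = S₂H⁻¹T₁`. [folklore] -/
theorem shift_bwd_relation (T₁ T₂ S₂ H Hi : R) (h : T₁ * T₂ = H * T₂ * T₁) (hS : T₂ * S₂ = 1)
    (hS' : S₂ * T₂ = 1) (hH : Hi * H = 1) : T₁ * S₂ = S₂ * Hi * T₁ := by
  have h1 : Hi * (T₁ * T₂) = T₂ * T₁ := by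
    rw [h, ← mul_assoc, ← mul_assoc, hH, one_mul]
  calc T₁ * S₂ = S₂ * T₂ * (T₁ * S₂) := by rw [hS', one_mul]
  _ = S₂ * (T₂ * T₁) * S₂ := by noncomm_ring
  _ = S₂ * (Hi * (T₁ * T₂)) * S₂ := by rw [h1]
  _ = S₂ * Hi * T₁ * (T₂ * S₂) := by noncomm_ring
  _ = S₂ * Hi * T₁ := by rw [hS, mul_one]

/-- **Datum for the backward transverse shift.**  `T₁S₂ − S₂T₁ = [S₂(H⁻¹ − 1)]·T₁`. [folklore] -/
theorem crossingDatum_bwd (T₁ T₂ S₂ H Hi : R) (h : T₁ * T₂ = H * T₂ * T₁) (hS : T₂ * S₂ = 1)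
    (hS' : S₂ * T₂ = 1) (hH : Hi * H = 1) :
    T₁ * S₂ - S₂ * T₁ = S₂ * (Hi - 1) * T₁ := by
  rw [shift_bwd_relation T₁ T₂ S₂ H Hi h hS hS' hH]; noncomm_ring

/-- Datum for the INVERSE shift `S₁` crossing `T₂`: `S₁T₂ − T₂S₁ = [−S₁(H − 1)T₂T₁]·S₁` — the opposite sign at
leading order, whence centred stencils `Σ_{|t|≤m} T₁^t` have first moment zero. [folklore] -/
theorem crossingDatum_inv (T₁ S₁ T₂ H : R) (h : T₁ * T₂ = H * T₂ * T₁) (hS : T₁ * S₁ = 1) (hS' : S₁ * T₁ = 1) :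
    S₁ * T₂ - T₂ * S₁ = -(S₁ * (H - 1) * T₂ * T₁) * S₁ := by
  have h1 : T₂ * S₁ = S₁ * H * T₂ := by
    calc T₂ * S₁ = S₁ * T₁ * T₂ * S₁ := by rw [hS', one_mul]
    _ = S₁ * (T₁ * T₂) * S₁ := by noncomm_ring
    _ = S₁ * (H * T₂ * T₁) * S₁ := by rw [h]
    _ = S₁ * H * T₂ * (T₁ * S₁) := by noncomm_ring
    _ = S₁ * H * T₂ := by rw [hS, mul_one]
  have h2 : S₁ * (H - 1) * T₂ * T₁ * S₁ = S₁ * (H - 1) * T₂ := by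
    rw [mul_assoc (S₁ * (H - 1) * T₂), hS, mul_one]
  rw [h1, neg_mul, h2]; noncomm_ring

/-- **Centred stencils.**  For `Σ_{|t|≤m} T₁^t = Σ_{t≤m} T₁^t + Σ_{0<t≤m} S₁^t` the two halves cross `X` with the
same moment `m(m+1)/2` and the data `E = M` and `E' = −S₁MT₁` (`crossingDatum_fwd`/`crossingDatum_inv` with
`M = (H − 1)T₂`, and likewise for the backward transverse shift), so the first-moment terms add up to
`m(m+1)/2 • (M − S₁MT₁)`, which is a GRADIENT WORD: `M − S₁MT₁ = (1 − S₁)·M·T₁ + M·(1 − T₁)` — a leftmost divergence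
or a difference on the argument.  With `M` the PAIR datum of `pair_leading` (weight 3) every term has weight ≥ 4: the
centred comb has no weight-3 crossing (dictionary; [toy]: centred blocks, 0 in all modes). [folklore] -/
theorem centred_moment_is_gradient (M T₁ S₁ : R) :
    M - S₁ * M * T₁ = (1 - S₁) * M * T₁ + M * (1 - T₁) := by
  noncomm_ring

/-- **The forward/backward PAIR at leading order.**  With `T₂S₂ = 1`, `H⁻¹H = 1`:
`(H − 1)T₂ + S₂(H⁻¹ − 1) = (H − 1)(T₂ − S₂) + [(H − 1) − S₂(H − 1)T₂]·S₂ + S₂H⁻¹(H − 1)²` —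
curvature × CENTRED DIFFERENCE + (covariant difference of the curvature) × shift + second order in the curvature.
The same lemma serves the compensated coarse pair `(Θ − 1)T^L + S^L(Θ⁻¹ − 1)` of §1. [folklore] -/
theorem pair_leading (T₂ S₂ H Hi : R) (hS : T₂ * S₂ = 1) (hH : Hi * H = 1) :
    (H - 1) * T₂ + S₂ * (Hi - 1)
      = (H - 1) * (T₂ - S₂) + ((H - 1) - S₂ * (H - 1) * T₂) * S₂ + S₂ * Hi * (H - 1) * (H - 1) := by
  have e1 : S₂ * (H - 1) * T₂ * S₂ = S₂ * (H - 1) := by rw [mul_assoc (S₂ * (H - 1)), hS, mul_one]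
  have e2 : Hi * (H - 1) = 1 - Hi := by rw [mul_sub, hH, mul_one]
  have e4 : (1 - Hi) * (H - 1) = (H - 1) - (1 - Hi) := by
    rw [sub_mul, one_mul, mul_sub, hH, mul_one]
  have e3 : S₂ * Hi * (H - 1) * (H - 1) = S₂ * ((H - 1) - (1 - Hi)) := by
    rw [mul_assoc S₂ Hi, e2, mul_assoc S₂ (1 - Hi), e4]
  rw [sub_mul ((H - 1)) (S₂ * (H - 1) * T₂) S₂, e1, e3]
  noncomm_ring

/-- **Crossing a full transverse Laplacian.**  For `X = T₂ + S₂ − 2` the data add: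
`T₁X − XT₁ = [(H − 1)T₂ + S₂(H⁻¹ − 1)]·T₁` — the datum `E = (H − 1)T₂ + S₂(H⁻¹ − 1)` required by
`crossing_moment` / `stencil_crossing`: a corner block sum in direction 1 crosses `Δ₂` with the weight-3 leading term
`L(L−1)/2 • [(H − 1)T₂ + S₂(H⁻¹ − 1)]`. [folklore] -/
theorem crossingDatum_lap (T₁ T₂ S₂ H Hi : R) (h : T₁ * T₂ = H * T₂ * T₁) (hS : T₂ * S₂ = 1)
    (hS' : S₂ * T₂ = 1) (hH : Hi * H = 1) :
    T₁ * (T₂ + S₂ - 2) - (T₂ + S₂ - 2) * T₁ = ((H - 1) * T₂ + S₂ * (Hi - 1)) * T₁ := by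
  have e : T₁ * (T₂ + S₂ - 2) - (T₂ + S₂ - 2) * T₁ = (T₁ * T₂ - T₂ * T₁) + (T₁ * S₂ - S₂ * T₁) := by
    simp only [mul_sub, sub_mul, mul_add, add_mul, mul_two, two_mul]; abel
  rw [e, crossingDatum_fwd T₁ T₂ H h, crossingDatum_bwd T₁ T₂ S₂ H Hi h hS hS' hH]
  noncomm_ring

/-- The (β) commutator `[T₁ − 1, Δ₂] = [(H − 1)T₂ + S₂(H⁻¹ − 1)]·T₁` (the identity shifts cancel): weight 3 on the
propagated function; by `pair_leading` its leading part is curvature × centred difference; it enters the defect only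
under `∇²G_f` and one coarse divergence (weight ≥ 4). [folklore] -/
theorem beta_commutator (T₁ T₂ S₂ H Hi : R) (h : T₁ * T₂ = H * T₂ * T₁) (hS : T₂ * S₂ = 1)
    (hS' : S₂ * T₂ = 1) (hH : Hi * H = 1) :
    (T₁ - 1) * (T₂ + S₂ - 2) - (T₂ + S₂ - 2) * (T₁ - 1) = ((H - 1) * T₂ + S₂ * (Hi - 1)) * T₁ := by
  rw [← crossingDatum_lap T₁ T₂ S₂ H Hi h hS hS' hH]
  generalize (T₂ + S₂ - 2) = X
  noncomm_ring

/-- **Block sum crossing a transverse Laplacian** (the weight-3 term of reading (α) made explicit):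
`(Σ_{t<n}T₁^t)·Δ₂ − Δ₂·(Σ_{t<n}T₁^t) = n(n−1)/2 • [(H − 1)T₂ + S₂(H⁻¹ − 1)] + (T₁ − 1)·A + B·(T₁ − 1)`. [folklore] -/
theorem blockSum_crossing_lap (T₁ T₂ S₂ H Hi : R) (h : T₁ * T₂ = H * T₂ * T₁) (hS : T₂ * S₂ = 1)
    (hS' : S₂ * T₂ = 1) (hH : Hi * H = 1) (n : ℕ) :
    (∑ t ∈ Finset.range n, T₁ ^ t) * (T₂ + S₂ - 2) - (T₂ + S₂ - 2) * (∑ t ∈ Finset.range n, T₁ ^ t)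
      = (n * (n - 1) / 2) • ((H - 1) * T₂ + S₂ * (Hi - 1))
        + (T₁ - 1) * (∑ t ∈ Finset.range n, crossA T₁ ((H - 1) * T₂ + S₂ * (Hi - 1)) t)
        + (∑ t ∈ Finset.range n, crossB T₁ ((H - 1) * T₂ + S₂ * (Hi - 1)) t) * (T₁ - 1) :=
  blockSum_crossing T₁ _ _ (crossingDatum_lap T₁ T₂ S₂ H Hi h hS hS' hH) n

/-- **The compensated coarse Laplacian** (B7 (15): coarse link `Θ·T^L`, `Θ` the excess of the averaged background
over the straight product, `Θi` its inverse): `Θ·P + M·Θi − 2 = (P + M − 2) + (Θ − 1)·P + M·(Θi − 1)` with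
`P = T^L`, `M = S^L` — straight coarse Laplacian plus the θ-pair, whose leading part `pair_leading` displays as
`(Θ − 1)(T^L − S^L) + …`. [folklore] -/
theorem coarseLap_compensated (P M Θ Θi : R) :
    Θ * P + M * Θi - 2 = (P + M - 2) + ((Θ - 1) * P + M * (Θi - 1)) := by
  noncomm_ring

end Crossing

/-! ## §3  (β) exactly: the covariant one-dimensional flux identity at `L = 2`, arbitrary link variables -/
section CovariantFlux

variable {R : Type*} [Ring R]

/-- Covariant one-dimensional Laplacian at a site, `(Δ_u f)(i) = u_i f(i+1) + v_{i−1} f(i−1) − 2 f(i)`, on the window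
letters `u = u_i` (transport of the fibre at `i+1` to `i`), `v = v_{i−1} = u_{i−1}⁻¹`, `fm, f, fp = f(i−1), f(i),
f(i+1)`. [model] [folklore] -/
def covLap (u v fm f fp : R) : R := u * fp + v * fm - 2 * f

/-- Covariant block SUM at `L = 2`, transported to the block corner: `(Q^Σf)(j) = f(2j) + u_{2j} f(2j+1)`.
[model] [folklore] -/
def covBlock₂ (u f fp : R) : R := f + u * fp

/-- The covariant flux functional at a coarse site (fine site `2j`): minus the covariant forward THIRD DIFFERENCE based
at `2j − 2`, every value transported to `2j`:  `g(j) = −[u_{2j}f(2j+1) − 3f(2j) + 3v_{2j−1}f(2j−1) −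
v_{2j−1}v_{2j−2}f(2j−2)]` (letters `u = u_{2j}`, `v = v_{2j−1}`, `v' = v_{2j−2}`). [model] [folklore] -/
def covThird₂ (u v v' fmm fm f fp : R) : R := -(u * fp - 3 * f + v * (3 * fm) - v * (v' * fmm))

/-- **(β) exactly: the covariant two-grid defect at `L = 2` is a covariant coarse divergence of the covariant third
difference**, for ARBITRARY link variables with two-sided inverses in any ring (no smallness, no commutativity):
`Q^Σ(4·Δ_u f)(j) − [U_j·(Q^Σf)(j+1) + V_{j−1}·(Q^Σf)(j−1) − 2(Q^Σf)(j)] = U_j·g(j+1) − g(j)`, `U_j = u_{2j}u_{2j+1}`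
the straight coarse link, `V_{j−1} = v_{2j−1}v_{2j−2}` the inverse coarse link from the left.  Window letters: `fₖ =
f(2j+k)`, `uₖ = u_{2j+k}`, `vₖ = v_{2j+k}`.  (The flat case is `T4TwoSpacingDefect`/`T4DefectFluxForm.defect₂_eq_cdiff
_flux₂` ×2; `L = 2, …, 6` [script].) [folklore] -/
theorem cov_flux_identity_two (fm2 fm1 f0 f1 f2 f3 um2 u0 u1 u2 vm2 vm1 v0 v1 : R)
    (h0 : u0 * v0 = 1) (h1 : u1 * v1 = 1) (hm2 : vm2 * um2 = 1) :
    covBlock₂ u0 (4 • covLap u0 vm1 fm1 f0 f1) (4 • covLap u1 v0 f0 f1 f2)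
        - (u0 * u1 * covBlock₂ u2 f2 f3 + vm1 * vm2 * covBlock₂ um2 fm2 fm1 - 2 • covBlock₂ u0 f0 f1)
      = u0 * u1 * covThird₂ u2 v1 v0 f0 f1 f2 f3 - covThird₂ u0 vm1 vm2 fm2 fm1 f0 f1 := by
  have h0x : ∀ x : R, u0 * (v0 * x) = x := fun x => by rw [← mul_assoc, h0, one_mul]
  have h1x : ∀ x : R, u1 * (v1 * x) = x := fun x => by rw [← mul_assoc, h1, one_mul]
  have hm2x : ∀ x : R, vm2 * (um2 * x) = x := fun x => by rw [← mul_assoc, hm2, one_mul]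
  simp only [covLap, covBlock₂, covThird₂, smul_add, smul_sub, mul_add, mul_sub, mul_neg, mul_smul_comm,
    mul_assoc, h0x, h1x, hm2x]
  noncomm_ring

/-- Sanity: with all links `= 1` the covariant identity is twice the flat one (block sums = 2 × block means); the
identity is uniform in the letters. -/
example (fm2 fm1 f0 f1 f2 f3 : R) :
    covBlock₂ 1 (4 • covLap 1 1 fm1 f0 f1) (4 • covLap 1 1 f0 f1 f2)
        - (1 * 1 * covBlock₂ 1 f2 f3 + 1 * 1 * covBlock₂ 1 fm2 fm1 - 2 • covBlock₂ 1 f0 f1)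
      = 1 * 1 * covThird₂ 1 1 1 f0 f1 f2 f3 - covThird₂ 1 1 1 fm2 fm1 f0 f1 :=
  cov_flux_identity_two fm2 fm1 f0 f1 f2 f3 1 1 1 1 1 1 1 1 (one_mul 1) (one_mul 1) (one_mul 1)

/-- Covariant block SUM at `L = 3`, transported to the block corner:
`(Q^Σf)(j) = f(3j) + u_{3j}f(3j+1) + u_{3j}u_{3j+1}f(3j+2)`. [model] [folklore] -/
def covBlock₃ (u u' f fp fpp : R) : R := f + u * fp + u * (u' * fpp)

/-- The `L = 3` flux functional on TRANSPORTED values `w_k` (= `f(3j+k)` carried to `3j`), stencil `−{1, 4, 1}` on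
the covariant forward third differences based at `3j − 3, 3j − 2, 3j − 1` (`T4DefectFluxForm.flux₃` ×3, made
covariant). [model] [folklore] -/
def covFlux₃ (wm3 wm2 wm1 w0 w1 w2 : R) : R :=
  -((w0 - 3 • wm1 + 3 • wm2 - wm3) + 4 • (w1 - 3 • w0 + 3 • wm1 - wm2) + (w2 - 3 • w1 + 3 • w0 - wm1))

/-- **(β) exactly at `L = 3`**: `Q^Σ(9·Δ_u f)(j) − [U_j(Q^Σf)(j+1) + V_{j−1}(Q^Σf)(j−1) − 2(Q^Σf)(j)] = U_j·g(j+1) −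
g(j)` with `U_j = u_{3j}u_{3j+1}u_{3j+2}`, `V_{j−1} = v_{3j−1}v_{3j−2}v_{3j−3}`, `g = covFlux₃` of the transported
values — arbitrary link variables with two-sided inverses, any ring.  Window letters `fₖ = f(3j+k)` etc.
[folklore] -/
theorem cov_flux_identity_three
    (fm3 fm2 fm1 f0 f1 f2 f3 f4 f5 um3 um2 u0 u1 u2 u3 u4 vm3 vm2 vm1 v0 v1 v2 : R)
    (h0 : u0 * v0 = 1) (h1 : u1 * v1 = 1) (h2 : u2 * v2 = 1) (hm3 : vm3 * um3 = 1) (hm2 : vm2 * um2 = 1) :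
    (9 • covLap u0 vm1 fm1 f0 f1 + u0 * (9 • covLap u1 v0 f0 f1 f2) + u0 * (u1 * (9 • covLap u2 v1 f1 f2 f3)))
        - (u0 * u1 * u2 * covBlock₃ u3 u4 f3 f4 f5 + vm1 * vm2 * vm3 * covBlock₃ um3 um2 fm3 fm2 fm1
            - 2 • covBlock₃ u0 u1 f0 f1 f2)
      = u0 * u1 * u2 * covFlux₃ (v2 * (v1 * (v0 * f0))) (v2 * (v1 * f1)) (v2 * f2) f3 (u3 * f4) (u3 * (u4 * f5))
        - covFlux₃ (vm1 * (vm2 * (vm3 * fm3))) (vm1 * (vm2 * fm2)) (vm1 * fm1) f0 (u0 * f1) (u0 * (u1 * f2)) := by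
  have h0x : ∀ x : R, u0 * (v0 * x) = x := fun x => by rw [← mul_assoc, h0, one_mul]
  have h1x : ∀ x : R, u1 * (v1 * x) = x := fun x => by rw [← mul_assoc, h1, one_mul]
  have h2x : ∀ x : R, u2 * (v2 * x) = x := fun x => by rw [← mul_assoc, h2, one_mul]
  have hm3x : ∀ x : R, vm3 * (um3 * x) = x := fun x => by rw [← mul_assoc, hm3, one_mul]
  have hm2x : ∀ x : R, vm2 * (um2 * x) = x := fun x => by rw [← mul_assoc, hm2, one_mul]
  simp only [covLap, covBlock₃, covFlux₃, smul_add, smul_sub, mul_add, mul_sub, mul_neg, mul_smul_comm,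
    mul_assoc, h0x, h1x, h2x, hm3x, hm2x]
  noncomm_ring

end CovariantFlux

/-! ## §4  (γ): two-path transports compare at the cost of the holonomy, telescoped (normed ring) -/
section Transport

variable {A : Type*} [NormedRing A]

/-- `X = H·Y` ⟹ `‖X − Y‖ ≤ ‖H − 1‖·‖Y‖`. [folklore] -/
theorem transport_compare (X Y H : A) (h : X = H * Y) : ‖X - Y‖ ≤ ‖H - 1‖ * ‖Y‖ := by
  rw [h, show H * Y - Y = (H - 1) * Y by noncomm_ring]
  exact norm_mul_le _ _

/-- **Telescoping along a chain of plaquette moves.**  `X_{i+1} = H_i·X_i` ⟹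
`‖X_n − X_0‖ ≤ Σ_{i<n} ‖H_i − 1‖·‖X_i‖` (comparing the two comb orders, or a comb transport with a straight one,
costs the sum of the holonomy defects of the plaquettes swept). [folklore] -/
theorem transport_chain (X H : ℕ → A) (h : ∀ i, X (i + 1) = H i * X i) :
    ∀ n, ‖X n - X 0‖ ≤ ∑ i ∈ Finset.range n, ‖H i - 1‖ * ‖X i‖
  | 0 => by simp
  | n + 1 => by
      rw [Finset.sum_range_succ, show X (n + 1) - X 0 = (X (n + 1) - X n) + (X n - X 0) by abel]
      exact (norm_add_le _ _).trans (by linarith [transport_compare _ _ _ (h n), transport_chain X H h n])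

/-- With contractions (`‖X_i‖ ≤ 1`, unitary link variables) and a uniform plaquette bound `‖H_i − 1‖ ≤ ε`:
`‖X_n − X_0‖ ≤ n·ε`. [folklore] -/
theorem transport_chain_uniform (X H : ℕ → A) (h : ∀ i, X (i + 1) = H i * X i) {ε : ℝ}
    (hH : ∀ i, ‖H i - 1‖ ≤ ε) (hX : ∀ i, ‖X i‖ ≤ 1) (n : ℕ) : ‖X n - X 0‖ ≤ n * ε := by
  refine (transport_chain X H h n).trans ?_
  calc ∑ i ∈ Finset.range n, ‖H i - 1‖ * ‖X i‖ ≤ ∑ _i ∈ Finset.range n, ε :=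
        Finset.sum_le_sum fun i _ =>
          (mul_le_mul (hH i) (hX i) (norm_nonneg _) ((norm_nonneg _).trans (hH i))).trans (by rw [mul_one])
  _ = n * ε := by rw [Finset.sum_const, Finset.card_range, nsmul_eq_mul]

end Transport

/-! ## §5  The weight budget of clause (F4): cubic remainders re-enter `FluxSized`, quadratic ones contradict it -/
section Budget

/-- **A weight-≥-4 (cubic) remainder is on budget.**  If (F1)(F2)(F3)(F5) hold with multiplier `λ̂` and the covariant
remainder obeys `0 ≤ blk ≤ C·(L⁻ᵏ)³` outright, then `FluxSized` holds with `λ̂' = max(λ̂, (L⁻ᵏ)³)`, `B' = max(B, 1)`,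
`C_B = C` — and `T4DefectFluxForm.ne3Shape_of_fluxSized_rpow` applies verbatim. [folklore] -/
theorem fluxSized_of_cubicBlk {ι : Type*} {dom : Set ι} {z dl phi blk lam : ℕ → ι → ℝ} {L CDL CΦ C B : ℝ}
    (hL : 1 ≤ L) (hCΦ : 0 ≤ CΦ) (hC : 0 ≤ C)
    (h1 : ∀ k : ℕ, ∀ V ∈ dom, z k V ≤ dl k V * phi k V * (2 + k * Real.log L) + blk k V)
    (h2 : ∀ k : ℕ, ∀ V ∈ dom, dl k V ≤ CDL * (1 + k * Real.log L))
    (h3 : ∀ k : ℕ, ∀ V ∈ dom, 0 ≤ phi k V ∧ phi k V ≤ CΦ * lam k V)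
    (h4 : ∀ k : ℕ, ∀ V ∈ dom, 0 ≤ blk k V ∧ blk k V ≤ C * (L⁻¹ ^ k) ^ 3)
    (h5 : ∀ k : ℕ, ∀ V ∈ dom, 0 ≤ lam k V ∧ lam k V ≤ B * (L⁻¹ ^ k) ^ 3) :
    FluxSized dom z dl phi blk (fun k V => max (lam k V) ((L⁻¹ ^ k) ^ 3)) L CDL CΦ C (max B 1) := by
  have hη : ∀ k : ℕ, (0 : ℝ) ≤ (L⁻¹ ^ k) ^ 3 := fun k => by positivity
  have hlog : 0 ≤ Real.log L := Real.log_nonneg hL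
  refine ⟨h1, h2, fun k V hV => ?_, fun k V hV => ?_, fun k V hV => ?_⟩
  · obtain ⟨hp0, hp⟩ := h3 k V hV
    exact ⟨hp0, hp.trans (mul_le_mul_of_nonneg_left (le_max_left _ _) hCΦ)⟩
  · obtain ⟨hb0, hb⟩ := h4 k V hV
    refine ⟨hb0, hb.trans ?_⟩
    have hsq : (1 : ℝ) ≤ (1 + k * Real.log L) ^ 2 := by
      have : (1 : ℝ) ≤ 1 + k * Real.log L := by
        have : (0 : ℝ) ≤ k * Real.log L := by positivity
        linarith
      nlinarith
    calc C * (L⁻¹ ^ k) ^ 3 = C * 1 * (L⁻¹ ^ k) ^ 3 := by ring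
    _ ≤ C * (1 + k * Real.log L) ^ 2 * max (lam k V) ((L⁻¹ ^ k) ^ 3) :=
        mul_le_mul (mul_le_mul_of_nonneg_left hsq hC) (le_max_right _ _) (hη k) (by positivity)
  · obtain ⟨hl0, hl⟩ := h5 k V hV
    refine ⟨le_max_of_le_left hl0, max_le ?_ ?_⟩
    · exact hl.trans (mul_le_mul_of_nonneg_right (le_max_left _ _) (hη k))
    · calc (L⁻¹ ^ k) ^ 3 = 1 * (L⁻¹ ^ k) ^ 3 := (one_mul _).symm
      _ ≤ max B 1 * (L⁻¹ ^ k) ^ 3 := mul_le_mul_of_nonneg_right (le_max_right _ _) (hη k)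

/-- **A weight-3 (quadratic) remainder is NOT on budget.**  If at one datum `V` the remainder is `≥ c·(L⁻ᵏ)²` for every
`k` (`c > 0`, `L > 1`) while the multiplier obeys (F5), `λ̂ ≤ B·(L⁻ᵏ)³`, then clause (F4) fails for every constant
`C_B ≥ 0`: `(1 + k log L)²·L⁻ᵏ → 0`.  This is the arithmetic behind "the first-moment term must be compensated".
[folklore] -/
theorem not_fluxClause4_of_quadratic {ι : Type*} {dom : Set ι} {blk lam : ℕ → ι → ℝ} {L CB B c : ℝ}
    (hL : 1 < L) (hc : 0 < c) (hCB : 0 ≤ CB) {V : ι} (hV : V ∈ dom)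
    (hblk : ∀ k : ℕ, c * (L⁻¹ ^ k) ^ 2 ≤ blk k V) (hlam : ∀ k : ℕ, lam k V ≤ B * (L⁻¹ ^ k) ^ 3) :
    ¬ (∀ k : ℕ, ∀ V ∈ dom, blk k V ≤ CB * (1 + k * Real.log L) ^ 2 * lam k V) := by
  intro h4
  have hL1 : (1 : ℝ) ≤ L := hL.le
  have hL0 : (0 : ℝ) < L := by linarith
  obtain ⟨hρ0, hρ1⟩ := rpowRate_lt_one hL (by norm_num : (0 : ℝ) < 1 / 2)
  set ρ : ℝ := L ^ (-(1 / 2 : ℝ)) with hρ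
  set c₂ : ℝ := logSqConst (1 / 2) with hc₂
  have hc₂0 : 0 < c₂ := logSqConst_pos (1 / 2) (by norm_num)
  set M : ℝ := max (CB * B * c₂) 1 with hM
  have hM0 : 0 < M := lt_of_lt_of_le one_pos (le_max_right _ _)
  -- for every k:  c ≤ M · ρ^k
  have key : ∀ k : ℕ, c ≤ M * ρ ^ k := by
    intro k
    have hη0 : (0 : ℝ) < L⁻¹ ^ k := pow_pos (inv_pos.mpr hL0) k
    have hlogk : 0 ≤ (1 + k * Real.log L) ^ 2 := sq_nonneg _
    have hA : c * (L⁻¹ ^ k) ^ 2 ≤ CB * (1 + k * Real.log L) ^ 2 * (B * (L⁻¹ ^ k) ^ 3) :=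
      (hblk k).trans ((h4 k V hV).trans (mul_le_mul_of_nonneg_left (hlam k) (mul_nonneg hCB hlogk)))
    have hB : (1 + k * Real.log L) ^ 2 * L⁻¹ ^ k ≤ c₂ * ρ ^ k := by
      have := one_add_mul_log_sq_mul_pow_le_rpow hL1 (by norm_num : (1 / 2 : ℝ) < 1) k
      simpa [hc₂, logSqConst, hρ] using this
    -- divide by η² > 0
    have hA' : c ≤ CB * B * ((1 + k * Real.log L) ^ 2 * L⁻¹ ^ k) := by
      have e : CB * (1 + k * Real.log L) ^ 2 * (B * (L⁻¹ ^ k) ^ 3)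
          = CB * B * ((1 + k * Real.log L) ^ 2 * L⁻¹ ^ k) * (L⁻¹ ^ k) ^ 2 := by ring
      rw [e] at hA
      exact le_of_mul_le_mul_right hA (by positivity)
    by_cases hCBB : 0 ≤ CB * B
    · calc c ≤ CB * B * ((1 + k * Real.log L) ^ 2 * L⁻¹ ^ k) := hA'
      _ ≤ CB * B * (c₂ * ρ ^ k) := mul_le_mul_of_nonneg_left hB hCBB
      _ = CB * B * c₂ * ρ ^ k := by ring
      _ ≤ M * ρ ^ k := mul_le_mul_of_nonneg_right (le_max_left _ _) (pow_nonneg hρ0 k)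
    · have hneg : CB * B * ((1 + k * Real.log L) ^ 2 * L⁻¹ ^ k) ≤ 0 :=
        mul_nonpos_of_nonpos_of_nonneg (le_of_lt (not_le.mp hCBB)) (by positivity)
      have : c ≤ 0 := hA'.trans hneg
      exact absurd this (not_le.mpr hc)
  obtain ⟨k, hk⟩ := exists_pow_lt_of_lt_one (div_pos hc hM0) hρ1
  have : M * ρ ^ k < c := by
    calc M * ρ ^ k < M * (c / M) := mul_lt_mul_of_pos_left hk hM0
    _ = c := mul_div_cancel₀ c hM0.ne'
  exact absurd (key k) (not_le.mpr this)

/-- The weights of the words met in §§1–2, as (m, r, s) = (leftmost coarse divergences, differences on the curvature,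
differences on the propagated function); on budget iff `m + r + s ≥ 2` (dictionary of the module docstring).  A
bookkeeping table, kernel-checked only for its arithmetic. [model] [folklore] -/
def onBudget (m r s : ℕ) : Bool := decide (2 ≤ m + r + s)

/-- first-moment term `m₁•(H−1)(T₂−S₂)` : (0,0,1) — NOT on budget; `m₁•(∇H)S₂` : (0,1,0) — NOT;
`(T₁−1)·A` with `A ∋ (H−1)(T₂−S₂)` : (1,0,1) — on budget; `B·(T₁−1)` : (0,0,2)/(0,1,1) — on budget;
second order `(H−1)²` counts as an extra curvature factor (weight +2) — on budget. -/
example : (onBudget 0 0 1, onBudget 0 1 0, onBudget 1 0 1, onBudget 0 0 2, onBudget 0 1 1, onBudget 2 0 0)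
    = (false, false, true, true, true, true) := by decide

end Budget

/-! ## §6  The Hölder budget: a `β`-deficient remainder clause still gives every rate `a < β` -/
section HolderBudget

/-- `FluxSizedHolder … β`: the flux-form wall `FluxSized` with clause (F4) WEAKENED to
(F4_β) `0 ≤ blk ≤ C_B·(1 + k log L)²·(L^{1−β})^k·λ̂` — the remainder may lose the factor `η^{β−1} = (L^{1−β})^k`
relative to the multiplier scale.  This is the typed size of a crossing word whose curvature DIFFERENCE is only
Hölder-`β` controlled (B11 (9) third clause `‖A‖_{1,β}`, `β ≤ β₀`; by reference to B8 (1.36), `β₀ < 1`) instead of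
Lipschitz (B11 (10): `|∂^{η*}∂^ηA|, |Δ^ηA| < B₃Mε₁(L^jη)^{−3}` — the Maxwell combinations only).  `β = 1` is `FluxSized`
(`fluxSizedHolder_one_iff`).  A predicate — never used as a fact. [model] [folklore] -/
def FluxSizedHolder {ι : Type*} (dom : Set ι) (z dl phi blk lam : ℕ → ι → ℝ) (L CDL CΦ CB B β : ℝ) : Prop :=
  (∀ k : ℕ, ∀ V ∈ dom, z k V ≤ dl k V * phi k V * (2 + k * Real.log L) + blk k V) ∧
  (∀ k : ℕ, ∀ V ∈ dom, dl k V ≤ CDL * (1 + k * Real.log L)) ∧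
  (∀ k : ℕ, ∀ V ∈ dom, 0 ≤ phi k V ∧ phi k V ≤ CΦ * lam k V) ∧
  (∀ k : ℕ, ∀ V ∈ dom, 0 ≤ blk k V ∧ blk k V ≤ CB * (1 + k * Real.log L) ^ 2 * (L ^ (1 - β)) ^ k * lam k V) ∧
  (∀ k : ℕ, ∀ V ∈ dom, 0 ≤ lam k V ∧ lam k V ≤ B * (L⁻¹ ^ k) ^ 3)

/-- At `β = 1` the Hölder wall IS the flux-form wall. [folklore] -/
theorem fluxSizedHolder_one_iff {ι : Type*} {dom : Set ι} {z dl phi blk lam : ℕ → ι → ℝ} {L CDL CΦ CB B : ℝ} :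
    FluxSizedHolder dom z dl phi blk lam L CDL CΦ CB B 1 ↔ FluxSized dom z dl phi blk lam L CDL CΦ CB B := by
  simp only [FluxSizedHolder, FluxSized, sub_self, Real.rpow_zero, one_pow, mul_one]

/-- The flux-form wall implies the Hölder wall for every `β ≤ 1` (`(L^{1−β})^k ≥ 1` for `L ≥ 1`). [folklore] -/
theorem fluxSizedHolder_of_fluxSized {ι : Type*} {dom : Set ι} {z dl phi blk lam : ℕ → ι → ℝ}
    {L CDL CΦ CB B β : ℝ} (h : FluxSized dom z dl phi blk lam L CDL CΦ CB B) (hL : 1 ≤ L) (hβ : β ≤ 1)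
    (hCB : 0 ≤ CB) : FluxSizedHolder dom z dl phi blk lam L CDL CΦ CB B β := by
  obtain ⟨h1, h2, h3, h4, h5⟩ := h
  refine ⟨h1, h2, h3, fun k V hV => ?_, h5⟩
  obtain ⟨hb0, hb⟩ := h4 k V hV
  obtain ⟨hl0, _⟩ := h5 k V hV
  have hW : (1 : ℝ) ≤ (L ^ (1 - β)) ^ k := one_le_pow₀ (Real.one_le_rpow hL (sub_nonneg.2 hβ))
  refine ⟨hb0, hb.trans ?_⟩
  have hA : 0 ≤ CB * (1 + k * Real.log L) ^ 2 * lam k V := by positivity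
  calc CB * (1 + ↑k * Real.log L) ^ 2 * lam k V = CB * (1 + ↑k * Real.log L) ^ 2 * 1 * lam k V := by ring
    _ ≤ CB * (1 + ↑k * Real.log L) ^ 2 * (L ^ (1 - β)) ^ k * lam k V := by
        have := mul_le_mul_of_nonneg_left hW hA
        nlinarith [this]

/-- **The Hölder wall ⇒ the size of the source**: `z ≤ (2·C_DL·C_Φ + C_B)·B·(1 + k log L)²·(L^{1−β})^k·η³`. [folklore] -/
theorem flux_clause1_holder {ι : Type*} {dom : Set ι} {z dl phi blk lam : ℕ → ι → ℝ} {L CDL CΦ CB B β : ℝ}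
    (h : FluxSizedHolder dom z dl phi blk lam L CDL CΦ CB B β) (hL : 1 ≤ L) (hβ : β ≤ 1) (hCDL : 0 ≤ CDL)
    (hCΦ : 0 ≤ CΦ) (hCB : 0 ≤ CB) :
    ∀ k, ∀ V ∈ dom,
      z k V ≤ (2 * CDL * CΦ + CB) * B * (1 + k * Real.log L) ^ 2 * (L ^ (1 - β)) ^ k * (L⁻¹ ^ k) ^ 3 := by
  obtain ⟨h1, h2, h3, h4, h5⟩ := h
  intro k V hV
  set y : ℝ := (k : ℝ) * Real.log L with hydef
  set η3 : ℝ := (L⁻¹ ^ k) ^ 3 with hη3def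
  set W : ℝ := (L ^ (1 - β)) ^ k with hWdef
  have hy : 0 ≤ y := mul_nonneg (Nat.cast_nonneg k) (Real.log_nonneg hL)
  have hW : 1 ≤ W := one_le_pow₀ (Real.one_le_rpow hL (sub_nonneg.2 hβ))
  obtain ⟨hphi0, hphi⟩ := h3 k V hV
  obtain ⟨_, hblk⟩ := h4 k V hV
  obtain ⟨hlam0, hlam⟩ := h5 k V hV
  have hc1 : 0 ≤ CDL * (1 + y) := mul_nonneg hCDL (by linarith)
  have hA : dl k V * phi k V ≤ CDL * (1 + y) * (CΦ * (B * η3)) := by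
    calc dl k V * phi k V ≤ CDL * (1 + y) * phi k V := mul_le_mul_of_nonneg_right (h2 k V hV) hphi0
      _ ≤ CDL * (1 + y) * (CΦ * (B * η3)) :=
          mul_le_mul_of_nonneg_left (hphi.trans (mul_le_mul_of_nonneg_left hlam hCΦ)) hc1
  have hBη : 0 ≤ B * η3 := hlam0.trans hlam
  have hP : 0 ≤ CDL * (1 + y) * (CΦ * (B * η3)) := mul_nonneg hc1 (mul_nonneg hCΦ hBη)
  have hB' : blk k V ≤ CB * (1 + y) ^ 2 * W * (B * η3) :=
    hblk.trans (mul_le_mul_of_nonneg_left hlam (by positivity))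
  have hflux : dl k V * phi k V * (2 + y) ≤ 2 * CDL * CΦ * B * (1 + y) ^ 2 * W * η3 := by
    calc dl k V * phi k V * (2 + y) ≤ CDL * (1 + y) * (CΦ * (B * η3)) * (2 + y) :=
          mul_le_mul_of_nonneg_right hA (by linarith)
      _ ≤ CDL * (1 + y) * (CΦ * (B * η3)) * (2 * (1 + y)) :=
          mul_le_mul_of_nonneg_left (by linarith) hP
      _ = 2 * CDL * CΦ * B * (1 + y) ^ 2 * 1 * η3 := by ring
      _ ≤ 2 * CDL * CΦ * B * (1 + y) ^ 2 * W * η3 := by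
          have h0 : 0 ≤ 2 * CDL * CΦ * B * (1 + y) ^ 2 * η3 := by
            have : 0 ≤ 2 * CDL * CΦ * (B * η3) * (1 + y) ^ 2 := by positivity
            linarith [this]
          nlinarith [mul_le_mul_of_nonneg_left hW h0]
  calc z k V ≤ dl k V * phi k V * (2 + y) + blk k V := h1 k V hV
    _ ≤ 2 * CDL * CΦ * B * (1 + y) ^ 2 * W * η3 + CB * (1 + y) ^ 2 * W * (B * η3) := add_le_add hflux hB'
    _ = (2 * CDL * CΦ + CB) * B * (1 + y) ^ 2 * W * η3 := by ring

/-- **Log² absorption at a Hölder-deficient scale**: `(1 + k log L)²·(L^{1−β})^k·L^{−k} ≤ β^{−2}·c₂(a/β)·(L^{−a})^k`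
for `L ≥ 1`, `0 < β ≤ 1`, `a < β` — `one_add_mul_log_sq_mul_pow_le_rpow` at the base `L^β`. [folklore] -/
theorem log_sq_holder_le_rpow {L a β : ℝ} (hL : 1 ≤ L) (hβ0 : 0 < β) (hβ1 : β ≤ 1) (ha : a < β) (k : ℕ) :
    (1 + k * Real.log L) ^ 2 * (L ^ (1 - β)) ^ k * L⁻¹ ^ k
      ≤ β⁻¹ ^ 2 * logSqConst (a / β) * (L ^ (-a)) ^ k := by
  have hL0 : 0 < L := by linarith
  set L' : ℝ := L ^ β with hL'
  have hL'1 : 1 ≤ L' := Real.one_le_rpow hL hβ0.le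
  have hL'0 : 0 < L' := by linarith
  have ha' : a / β < 1 := (div_lt_one hβ0).2 ha
  -- the product of the two scale factors is `L'⁻¹ ^ k`
  have hprod : (L ^ (1 - β)) ^ k * L⁻¹ ^ k = L'⁻¹ ^ k := by
    rw [← mul_pow]
    congr 1
    rw [hL', ← Real.rpow_neg_one L, ← Real.rpow_add hL0, ← Real.rpow_neg hL0.le]
    congr 1; ring
  -- the logarithm at base `L'`
  have hlog : Real.log L = β⁻¹ * Real.log L' := by
    rw [hL', Real.log_rpow hL0]; field_simp
  have hy' : 0 ≤ (k : ℝ) * Real.log L' := mul_nonneg (Nat.cast_nonneg k) (Real.log_nonneg hL'1)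
  have hβinv : 1 ≤ β⁻¹ := one_le_inv_iff₀.2 ⟨hβ0, hβ1⟩
  have h1 : 1 + k * Real.log L ≤ β⁻¹ * (1 + k * Real.log L') := by
    rw [hlog]
    nlinarith [hβinv, hy']
  have h1' : 0 ≤ 1 + k * Real.log L := by
    have : 0 ≤ (k : ℝ) * Real.log L := mul_nonneg (Nat.cast_nonneg k) (Real.log_nonneg hL)
    linarith
  have h2 : (1 + k * Real.log L) ^ 2 ≤ (β⁻¹ * (1 + k * Real.log L')) ^ 2 := pow_le_pow_left₀ h1' h1 2
  have hmain := one_add_mul_log_sq_mul_pow_le_rpow hL'1 ha' k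
  have hrate : L' ^ (-(a / β)) = L ^ (-a) := by
    rw [hL', ← Real.rpow_mul hL0.le]
    congr 1; field_simp
  calc (1 + k * Real.log L) ^ 2 * (L ^ (1 - β)) ^ k * L⁻¹ ^ k
      = (1 + k * Real.log L) ^ 2 * ((L ^ (1 - β)) ^ k * L⁻¹ ^ k) := by ring
    _ = (1 + k * Real.log L) ^ 2 * L'⁻¹ ^ k := by rw [hprod]
    _ ≤ (β⁻¹ * (1 + k * Real.log L')) ^ 2 * L'⁻¹ ^ k :=
        mul_le_mul_of_nonneg_right h2 (by positivity)
    _ = β⁻¹ ^ 2 * ((1 + k * Real.log L') ^ 2 * L'⁻¹ ^ k) := by ring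
    _ ≤ β⁻¹ ^ 2 * (logSqConst (a / β) * (L' ^ (-(a / β))) ^ k) :=
        mul_le_mul_of_nonneg_left hmain (by positivity)
    _ = β⁻¹ ^ 2 * logSqConst (a / β) * (L ^ (-a)) ^ k := by rw [hrate]; ring

/-- **OSC from a Hölder-deficient source at every rate `a < β`.**  Source `z ≤ C_Z·B·(1 + k log L)²·(L^{1−β})^k·η³`
+ boundary term + oscillation readings ⟹ `OneStepCorrectionRate dom osc ((1 + C_D)(1 + C_Π)·C_Z·B·β^{−2}c₂(a/β) + B₀C_R)
(L^{−a})`. [folklore] -/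
theorem oneStepCorrectionRate_of_fluxHolder_rpow {ι : Type*} {dom : Set ι} (z t osc : ℕ → ι → ℝ)
    {L a β CP CD CZ B B0 CR : ℝ} (hL : 1 ≤ L) (hβ0 : 0 < β) (hβ1 : β ≤ 1) (ha : a < β) (hCP : 0 ≤ CP)
    (hCD : 0 ≤ CD) (hCZ : 0 ≤ CZ) (hB : 0 ≤ B) (hB0 : 0 ≤ B0) (hCR : 0 ≤ CR)
    (hz : ∀ k, ∀ V ∈ dom, z k V ≤ CZ * B * (1 + k * Real.log L) ^ 2 * (L ^ (1 - β)) ^ k * (L⁻¹ ^ k) ^ 3)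
    (ht : ∀ k, ∀ V ∈ dom, t k V ≤ B0 * CR * L⁻¹ ^ k)
    (hosc : ∀ k, ∀ V ∈ dom, osc k V ≤ (1 + CD) * (1 + CP) * z k V / (L⁻¹ ^ k) ^ 2 + t k V) :
    OneStepCorrectionRate dom osc
      ((1 + CD) * (1 + CP) * CZ * B * (β⁻¹ ^ 2 * logSqConst (a / β)) + B0 * CR) (L ^ (-a)) := by
  intro k V hV
  set η : ℝ := L⁻¹ ^ k with hη
  set ϑ : ℝ := (L ^ (-a)) ^ k with hϑ
  set W : ℝ := (L ^ (1 - β)) ^ k with hW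
  set c : ℝ := β⁻¹ ^ 2 * logSqConst (a / β) with hc
  have hL0 : 0 < L := by linarith
  have hη0 : 0 < η := by positivity
  have ha1 : a ≤ 1 := (ha.trans_le hβ1).le
  have hc0 : 0 ≤ c := mul_nonneg (by positivity) (logSqConst_pos _ ((div_lt_one hβ0).2 ha)).le
  have hϑ0 : 0 ≤ ϑ := pow_nonneg (Real.rpow_nonneg hL0.le _) k
  have hηϑ : η ≤ ϑ := inv_pow_le_rpow_pow hL ha1 k
  have hlogϑ : (1 + k * Real.log L) ^ 2 * W * η ≤ c * ϑ := log_sq_holder_le_rpow hL hβ0 hβ1 ha k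
  have hzk := hz k V hV
  have htk := ht k V hV
  have hA : 0 ≤ (1 + CD) * (1 + CP) := by positivity
  have hZB : 0 ≤ CZ * B := by positivity
  have h1 : (1 + CD) * (1 + CP) * z k V / η ^ 2 ≤ (1 + CD) * (1 + CP) * CZ * B * c * ϑ := by
    rw [div_le_iff₀ (by positivity)]
    have h1a : z k V ≤ CZ * B * (c * ϑ) * η ^ 2 := by
      calc z k V ≤ CZ * B * (1 + k * Real.log L) ^ 2 * W * η ^ 3 := hzk
        _ = CZ * B * ((1 + k * Real.log L) ^ 2 * W * η) * η ^ 2 := by ring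
        _ ≤ CZ * B * (c * ϑ) * η ^ 2 :=
          mul_le_mul_of_nonneg_right (mul_le_mul_of_nonneg_left hlogϑ hZB) (by positivity)
    calc (1 + CD) * (1 + CP) * z k V ≤ (1 + CD) * (1 + CP) * (CZ * B * (c * ϑ) * η ^ 2) :=
          mul_le_mul_of_nonneg_left h1a hA
      _ = (1 + CD) * (1 + CP) * CZ * B * c * ϑ * η ^ 2 := by ring
  have h2 : t k V ≤ B0 * CR * ϑ := htk.trans (mul_le_mul_of_nonneg_left hηϑ (by positivity))
  calc osc k V ≤ (1 + CD) * (1 + CP) * z k V / η ^ 2 + t k V := hosc k V hV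
    _ ≤ (1 + CD) * (1 + CP) * CZ * B * c * ϑ + B0 * CR * ϑ := add_le_add h1 h2
    _ = ((1 + CD) * (1 + CP) * CZ * B * c + B0 * CR) * ϑ := by ring

/-- **The Hölder wall by name ⇒ OSC at every rate `a < β`.** [folklore] -/
theorem oneStepCorrectionRate_of_fluxSizedHolder_rpow {ι : Type*} {dom : Set ι}
    {z dl phi blk lam t osc : ℕ → ι → ℝ} {L CDL CΦ CB B β CP CD B0 CR : ℝ}
    (h : FluxSizedHolder dom z dl phi blk lam L CDL CΦ CB B β) {a : ℝ}
    (hL : 1 ≤ L) (hβ0 : 0 < β) (hβ1 : β ≤ 1) (ha : a < β) (hCDL : 0 ≤ CDL) (hCΦ : 0 ≤ CΦ) (hCB : 0 ≤ CB)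
    (hCP : 0 ≤ CP) (hCD : 0 ≤ CD) (hB : 0 ≤ B) (hB0 : 0 ≤ B0) (hCR : 0 ≤ CR)
    (ht : ∀ k, ∀ V ∈ dom, t k V ≤ B0 * CR * L⁻¹ ^ k)
    (hosc : ∀ k, ∀ V ∈ dom, osc k V ≤ (1 + CD) * (1 + CP) * z k V / (L⁻¹ ^ k) ^ 2 + t k V) :
    OneStepCorrectionRate dom osc
      ((1 + CD) * (1 + CP) * (2 * CDL * CΦ + CB) * B * (β⁻¹ ^ 2 * logSqConst (a / β)) + B0 * CR) (L ^ (-a)) :=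
  oneStepCorrectionRate_of_fluxHolder_rpow z t osc hL hβ0 hβ1 ha hCP hCD (by positivity) hB hB0 hCR
    (flux_clause1_holder h hL hβ1 hCDL hCΦ hCB) ht hosc

/-- **The Hölder wall by name ⇒ the node's shape by name at every rate `0 < a < β ≤ 1`** (`L > 1`):
`FluxSizedHolder … β` + (T5) + (I′)(I″) + reading / response / pairing + "act = Σ_x loc, card X ≤ vol" ⟹
`T4EtaRateMin.NE3Shape R C (L^{−a})`.  Since for every `a < 1` there is a `β ∈ ]a, 1[`, a Hölder-`β₀` curvature input
for EVERY `β₀ < 1` (constants depending on `β₀`) still yields the shape at every rate `a < 1`. [folklore] -/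
theorem ne3Shape_of_fluxSizedHolder_rpow {ι X : Type*} [Fintype X] {R : Readings ι X}
    {z dl phi blk lam t osc nrm pair : ℕ → ι → ℝ} {L CDL CΦ CB B β CP CD B0 CR Γ Λr ρ₂ a : ℝ}
    (h : FluxSizedHolder R.dom z dl phi blk lam L CDL CΦ CB B β)
    (hL : 1 < L) (ha0 : 0 < a) (ha : a < β) (hβ1 : β ≤ 1) (hCDL : 0 ≤ CDL) (hCΦ : 0 ≤ CΦ) (hCB : 0 ≤ CB)
    (hCP : 0 ≤ CP) (hCD : 0 ≤ CD) (hB : 0 ≤ B) (hB0 : 0 ≤ B0) (hCR : 0 ≤ CR) (hΓ : 0 ≤ Γ) (hΛr : 0 ≤ Λr)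
    (hρ₂ : 0 ≤ ρ₂)
    (ht : ∀ k, ∀ V ∈ R.dom, t k V ≤ B0 * CR * L⁻¹ ^ k)
    (hosc : ∀ k, ∀ V ∈ R.dom, osc k V ≤ (1 + CD) * (1 + CP) * z k V / (L⁻¹ ^ k) ^ 2 + t k V)
    (hact : ∀ k : ℕ, ∀ V ∈ R.dom, R.act k V = ∑ x, R.loc k V x) (hvol : (Fintype.card X : ℝ) ≤ R.vol)
    (hread : ∀ k : ℕ, ∀ V ∈ R.dom, ∀ x : X,
      |R.loc (k + 1) V x - R.loc k V x| ≤ Λr * nrm k V + pair k V)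
    (hresp : ∀ k : ℕ, ∀ V ∈ R.dom, nrm k V ≤ Γ * osc k V)
    (hpair : OneStepCorrectionRate R.dom pair ρ₂ (L ^ (-a))) :
    NE3Shape R
      (Λr * Γ * ((1 + CD) * (1 + CP) * (2 * CDL * CΦ + CB) * B * (β⁻¹ ^ 2 * logSqConst (a / β)) + B0 * CR)
        + ρ₂) (L ^ (-a)) := by
  have hβ0 : 0 < β := ha0.trans ha
  have hone := oneStepCorrectionRate_of_fluxSizedHolder_rpow h hL.le hβ0 hβ1 ha hCDL hCΦ hCB hCP hCD hB
    hB0 hCR ht hosc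
  have hloc := localRate_of_oneStep' nrm osc pair hΓ hΛr hread hresp hone hpair
  obtain ⟨h0, h1⟩ := rpowRate_lt_one hL ha0
  have hlog : 0 < logSqConst (a / β) := logSqConst_pos _ ((div_lt_one hβ0).2 ha)
  have h1CD : (0 : ℝ) ≤ 1 + CD := by linarith
  have h1CP : (0 : ℝ) ≤ 1 + CP := by linarith
  have h2C : (0 : ℝ) ≤ 2 * CDL * CΦ + CB := by positivity
  have hC : 0 ≤ Λr * Γ * ((1 + CD) * (1 + CP) * (2 * CDL * CΦ + CB) * B * (β⁻¹ ^ 2 * logSqConst (a / β))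
      + B0 * CR) + ρ₂ :=
    add_nonneg (mul_nonneg (mul_nonneg hΛr hΓ) (add_nonneg
      (mul_nonneg (mul_nonneg (mul_nonneg (mul_nonneg h1CD h1CP) h2C) hB) (by positivity))
      (mul_nonneg hB0 hCR))) hρ₂
  exact ⟨h0, h1, actionRate_of_localRate hact hvol hC h0 hloc, hloc⟩

/-- The flux-form theorem is the `β = 1` case: a consistency check that the Hölder chain specialises correctly
(the constant reads `1⁻¹²·c₂(a/1)`). [folklore] -/
example {ι : Type*} {dom : Set ι} {z dl phi blk lam t osc : ℕ → ι → ℝ} {L CDL CΦ CB B CP CD B0 CR a : ℝ}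
    (h : FluxSized dom z dl phi blk lam L CDL CΦ CB B) (hL : 1 ≤ L) (ha : a < 1)
    (hCDL : 0 ≤ CDL) (hCΦ : 0 ≤ CΦ) (hCB : 0 ≤ CB) (hCP : 0 ≤ CP) (hCD : 0 ≤ CD) (hB : 0 ≤ B) (hB0 : 0 ≤ B0)
    (hCR : 0 ≤ CR) (ht : ∀ k, ∀ V ∈ dom, t k V ≤ B0 * CR * L⁻¹ ^ k)
    (hosc : ∀ k, ∀ V ∈ dom, osc k V ≤ (1 + CD) * (1 + CP) * z k V / (L⁻¹ ^ k) ^ 2 + t k V) :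
    OneStepCorrectionRate dom osc
      ((1 + CD) * (1 + CP) * (2 * CDL * CΦ + CB) * B * ((1 : ℝ)⁻¹ ^ 2 * logSqConst (a / 1)) + B0 * CR)
        (L ^ (-a)) :=
  oneStepCorrectionRate_of_fluxSizedHolder_rpow (fluxSizedHolder_one_iff.2 h) hL one_pos le_rfl ha hCDL hCΦ
    hCB hCP hCD hB hB0 hCR ht hosc

/-- The printed-regularity refinement of the word budget: a curvature factor differenced `r ≥ 1` times is sized by
ONE printed difference only (`|∇²F| ≤ 2 sup|∇F|` on the lattice; B11 (10) prints the Maxwell combinations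
`∂^{η*}∂^ηA`, `Δ^ηA` at the scale `(L^jη)^{−3}`, nothing at `(L^jη)^{−4}`), so the gain from `r` saturates at one:
on the PRINTED budget iff `m + min r 1 + s ≥ 2`. [model] [folklore] -/
def onPrintedBudget (m r s : ℕ) : Bool := decide (2 ≤ m + min r 1 + s)

/-- `(∇²F)·u` = (0,2,0): on the formal budget, NOT on the printed one; `∂_c[(∇²F)u]` = (1,2,0) and `(∇F)·∇u` = (0,1,1)
are on both; the first-moment words (0,0,1), (0,1,0) on neither. -/
example : (onBudget 0 2 0, onPrintedBudget 0 2 0, onPrintedBudget 1 2 0, onPrintedBudget 0 1 1,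
    onPrintedBudget 0 0 1, onPrintedBudget 0 1 0) = (true, false, true, true, false, false) := by decide

end HolderBudget

/-! ## §7  Vector averaging: the transported gauge mode telescopes along any contour (exact, any ring) -/
section ContourGauge

variable {R : Type*} [Ring R]

/-- TELESCOPING ALONG A CONTOUR.  Walk a contour bond by bond; `P k` is the transport from the `k`-th vertex back to the
base point and `lam k` the gauge function at the `k`-th vertex.  If every bond term equals
`P (k+1) * lam (k+1) - P k * lam k` — forward bonds by `contourTerm_fwd`, bonds met backwards by `contourTerm_bwd` —
the contour sum is `P n * lam n - P 0 * lam 0`: only the endpoints survive. [folklore] -/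
theorem contour_telescope (P lam t : ℕ → R) (n : ℕ)
    (ht : ∀ k < n, t k = P (k + 1) * lam (k + 1) - P k * lam k) :
    ∑ k ∈ Finset.range n, t k = P n * lam n - P 0 * lam 0 := by
  rw [Finset.sum_congr rfl (fun k hk => ht k (Finset.mem_range.1 hk))]
  exact Finset.sum_range_sub (fun k => P k * lam k) n

/-- Forward bond `⟨z_k, z_k + e_μ⟩`: the transported linearised gauge mode `P_k·(ℓ_k·λ_{k+1} − λ_k)` (B9 (3.3):
`(D_μλ)(x) = η⁻¹(R(U(x, x+μ))λ(x+μ) − λ(x))`; (3.5): the bond variable transforms at its initial point), with the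
transport update `P_{k+1} = P_kℓ_k`, is a telescoping term. [folklore] -/
theorem contourTerm_fwd {Pk Pk1 ℓ lamk lamk1 : R} (hP : Pk1 = Pk * ℓ) :
    Pk * (ℓ * lamk1 - lamk) = Pk1 * lamk1 - Pk * lamk := by
  rw [hP]; noncomm_ring

/-- Backward bond: the walk steps from `z_k` to `z_{k+1} = z_k − e_μ` across `⟨z_{k+1}, z_k⟩`, whose variable
`ℓ·λ_k − λ_{k+1}` sits at `z_{k+1}` and enters with a MINUS sign (B7 (14): the returning leg `Γ_{x(c),c₊}` is the comb
contour reversed, `A(Γ_{x(c),c₊}) = −A(Γ_{c₊,x(c)})`); transport update through the inverse link, `P_{k+1}·ℓ = P_k`.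
Again a telescoping term. [folklore] -/
theorem contourTerm_bwd {Pk Pk1 ℓ lamk lamk1 : R} (hP : Pk1 * ℓ = Pk) :
    -(Pk1 * (ℓ * lamk - lamk1)) = Pk1 * lamk1 - Pk * lamk := by
  rw [← hP]; noncomm_ring

/-- THE GAUGE-MODE IDENTITY OF THE VECTOR AVERAGING (shape of B7 (14) / the main term of (124) / CMP 95 (1.8)): for
every block point `x` the contour sum of the transported gauge mode from `y` (`P = 1`) to `y + Lν` is
`P_x(end)·λ(y + Lν) − λ(y)` (`contour_telescope`), so the block SUM is `(Σ_x P_x(end))·λ(y + Lν) − |B(y)|·λ(y)`: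
after the normalisation `L^{−(d+1)}`, a COARSE gauge mode `L⁻¹[P̄·λ(y + Lν) − λ(y)]` whose transport `P̄` is the block
MEAN of the contour holonomies — the pre-projection average of B7 (15).  [toy `g8/toy_vec2d.py`: 6.9·10⁻¹⁷.]
[folklore] -/
theorem contourSum_gauge {ι : Type*} (s : Finset ι) (Pend S : ι → R) (lamEnd lam0 : R)
    (hS : ∀ x ∈ s, S x = Pend x * lamEnd - lam0) :
    ∑ x ∈ s, S x = (∑ x ∈ s, Pend x) * lamEnd - s.card • lam0 := by
  rw [Finset.sum_congr rfl hS, Finset.sum_sub_distrib, Finset.sum_mul, Finset.sum_const]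

/-- A three-bond contour with concrete letters — two forward bonds (links `ℓ₁`, `ℓ₂`) and one met backwards (link `m`,
new transport `u` with `u·m = ℓ₁ℓ₂`): the sum of the three bond terms is `u·λ₃ − λ₀`. -/
example (ℓ₁ ℓ₂ m u lam0 lam1 lam2 lam3 : R) (hu : u * m = ℓ₁ * ℓ₂) :
    1 * (ℓ₁ * lam1 - lam0) + ℓ₁ * (ℓ₂ * lam2 - lam1) + -(u * (m * lam2 - lam3)) = u * lam3 - 1 * lam0 := by
  have h1 := contourTerm_fwd (Pk := (1 : R)) (ℓ := ℓ₁) (lamk := lam0) (lamk1 := lam1) (Pk1 := ℓ₁) (by simp)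
  have h2 := contourTerm_fwd (Pk := ℓ₁) (ℓ := ℓ₂) (lamk := lam1) (lamk1 := lam2) (Pk1 := ℓ₁ * ℓ₂) rfl
  have h3 := contourTerm_bwd (Pk := ℓ₁ * ℓ₂) (Pk1 := u) (ℓ := m) (lamk := lam2) (lamk1 := lam3) hu
  rw [h1, h2, h3]; abel

end ContourGauge

end Literature.MathematicalPhysics.QuantumFieldTheory.Balaban1983to89.T4CovariantDefectAlgebra

end
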